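import Literature.MathematicalPhysics.QuantumFieldTheory.Balaban1983to89.Node00.Record13DatumKeyCoPR
import Literature.MathematicalPhysics.QuantumFieldTheory.Balaban1983to89.Node00.Record13DatumKeySepCoP
import Literature.MathematicalPhysics.QuantumFieldTheory.Balaban1983to89.Node00.Record13SepCoPR

/-!
# NODE 00 (YM-PLAN Track A) — THE STAGE-13 DATUM ∕ RECORD KEYS ON THE PROVISOS OF RECORD OF THE v1.6 `CoPR` EDITION, `Stage13RParams.Provisos₁₃SepCoPR`
# (def-T `Node00/Record13SepCoPR` = RECORD 13 v1.6, FILE 26T): `IsDatumOfRecord₁₃CSepCoPR` (+ `.params ∕ .provisos`, `canon₁₃SepCoPR`, `IsRateKey₁₃SepCoPR`), the regime keys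
# `IsDatumOfRecord₁₃CSepCoPROn ∕ IsRecordOfRecord₁₃CSepCoPROn ∕ canon₁₃SepCoPROn`, the CN keys `IsDatumOfRecord₁₃CSepCoPRN ∕ IsRecordOfRecord₁₃CSepCoPRN` at the re-issued guard
# `unityNondeg₁₃R N` (`Node00/Record13DatumKeyCoPR` §7), the one-way bridges INTO the `CoPR` keys (§8, along def-T's `Provisos₁₃SepCoPR.toCore`, datum by `rfl`) and the one-way
# run-blind doors `…SepCoP → …SepCoPR` (§9, along def-T's `Stage13RParams.ofRunBlind`)

NODE 00 RECORD MODULE (cell `pub-ymgap`, seat `pub-ymgap-node00-def-RR-2` gen 12 = second reader ∕ key + instance side of the RATE-RECORD HOME, director-ym R141 (A);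
dag-lead «datum-KEY twin leaf = RR-2 lineage, one declarer»).  THE `SepCoPR` TWIN (v1.6 EDITION) of this seat's `Node00/Record13DatumKeySepCoP` (p522143; the v1.5 item-facing
keys over `Stage13Params.Provisos₁₃SepCoP` and `datumOfRecord₁₃SepCoP`).  THE v1.6 EDITION, SAID ONCE (def-T `KEYMAP-Record13-v1.6.md`, KEY-RULE-25 + the FILE-26T names;
FINDING №8 ∕ director-ym №169 H1 ∕ №174; route rev 22): the residual 𝐓-weight of RECORD 13 is RUN-INDEXED — def-T's `structure Stage13RParams F N extends Stage13Params F N` with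
the ONE new field `Zr : (p : B12.RunParams) → TkResidualW F N (FluctV N) p.K` ([III] (1.11) p.248, (2.4) p.255, p.267); the PROVISOS OF RECORD are `Stage13RParams.Provisos₁₃SepCoPR`
(FILE 26T: the v1.5 rows of `Provisos₁₃SepCoP` VERBATIM at `θ.toStage13Params`, the residual rows `zrLaws ∕ zrLocal` on `θ.Zr`, the background-field row `bg` unchanged), with
def-T's projection `Stage13RParams.Provisos₁₃SepCoPR.toCore : θ.Provisos₁₃SepCoPR F N → θ.Provisos₁₃CoPR F N` and the datum `datumOfRecord₁₃SepCoPR F N θ h :=` the core datum at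
`h.toCore` (`datumOfRecord₁₃SepCoPR_eq_coPR`, `rfl`); the record predicate is `IsRecordOfRecord₁₃CSepCoPR` (+ `.toCoPR`).  The route's ITEM texts of rev 22 key on these names
(K0⁶ `Record13SepCoPRInhabited` reads «`∃ θ : Stage13RParams F 2, ∃ h : θ.Provisos₁₃SepCoPR F 2, (θ.ZrUnity F 2 ∧ θ.SlotsNondegenerate₁₃ F 2) ∧ θ.Admissible F 2 ∧ …`»; the
∀-items' binder prefix is `∀ (θ : Stage13RParams F N) (h : θ.Provisos₁₃SepCoPR F N), (θ.ZrUnity F N ∧ θ.SlotsNondegenerate₁₃ F N) → θ.Admissible F N → … (datumOfRecord₁₃SepCoPR F N θ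
h) …` = the literal face `forall_isRecordOfRecord₁₃CSepCoPRN_iff` below).  This module is the token map applied to `Node00/Record13DatumKeySepCoP`: EVERY declaration of §1–§8
below is the v1.5-keyed declaration with binder `(θ : Stage13Params F N) ↦ (θ : Stage13RParams F N)` (also inside `Rg : (F : T4Family) → Stage13RParams F N → Prop` and the
canonical readings' value types), `(h : θ.Provisos₁₃SepCoP F N) ↦ (h : θ.Provisos₁₃SepCoPR F N)`, `datumOfRecord₁₃SepCoP ↦ datumOfRecord₁₃SepCoPR`, `θ.toStage5₁₃CoP ↦
θ.toStage5₁₃CoPR`, `IsRecordOfRecord₁₃CSepCoP… ↦ IsRecordOfRecord₁₃CSepCoPR…`, `θ.ZtUnity ↦ θ.ZrUnity`, `unityNondeg₁₃ ↦ unityNondeg₁₃R`, and in §8 the target classes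
`…CCoP… ↦ …CCoPR…`, `IsRateKey₁₃CoP ↦ IsRateKey₁₃CoPR`, bridge names `.toCoP ↦ .toCoPR`, in statement and proof, under the NAME RULE «def-T's token `SepCoPR` at def-T's position»:
`IsDatumOfRecord₁₃CSepCoP[On∕N] ↦ IsDatumOfRecord₁₃CSepCoPR[On∕N]`, `IsRecordOfRecord₁₃CSepCoP(On∕N) ↦ IsRecordOfRecord₁₃CSepCoPR(On∕N)`, `canon₁₃SepCoP[On] ↦ canon₁₃SepCoPR[On]`,
`IsRateKey₁₃SepCoP ↦ IsRateKey₁₃SepCoPR`, the theorem stems likewise (ONE face renamed with its content: `IsDatumOfRecord₁₃CSepCoPN.ztUnity ↦ IsDatumOfRecord₁₃CSepCoPRN.zrUnity`),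
and the SITE-RULE at the θ-level read-off faces (`….βfun_eq_betaOfRecord₁₃ : D.βfun = betaOfRecord₁₃ F N h.params.toStage13Params`, `….flow_g : … = gOfRecord₁₃ F N
h.params.toStage13Params p`) — the 112 declarations of the v1.5 leaf map onto the 112 of §1–§8 ONE FOR ONE, statement AND proof (checked byte for byte against the landed file
before filing).  KEYED FLAT on `datumOfRecord₁₃SepCoPR` (the token the rev-22 item texts carry).  APPEND-ONLY: a NEW leaf importing this seat's `Node00/Record13DatumKeyCoPR` (the
`CoPR` keys and the guard `unityNondeg₁₃R`), this seat's `Node00/Record13DatumKeySepCoP` (the v1.5 classes, for §9) and def-T's `Node00/Record13SepCoPR`; NOTHING landed is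
edited — every earlier key module stands VERBATIM.

CONSUMED BY NAME from def-T's `Node00/Record13SepCoPR`: `Stage13RParams.Provisos₁₃SepCoPR` (+ `.toCore`), `datumOfRecord₁₃SepCoPR`, `datumOfRecord₁₃SepCoPR_eq_coPR`,
`IsRecordOfRecord₁₃CSepCoPR` (+ `.toCoPR`), `exists_world_isRecordOfRecord₁₃CSepCoPR`, `exists_provisos_of_isRecordOfRecord₁₃CSepCoPR`,
`exists_isRecordOfRecord₅C_of_isRecordOfRecord₁₃CSepCoPR`, the `rfl` ∕ read-off faces `βfun_ ∕ flow_g_ ∕ av_ ∕ isDatumOfRecord₀_datumOfRecord₁₃SepCoPR`,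
`isPrintedAveraged_datumOfRecord₁₃SepCoPR`, and — for §9 only — `Stage13Params.Provisos₁₃SepCoP.ofRunBlind`, `datumOfRecord₁₃SepCoPR_ofRunBlind` (`rfl`); from `Node00/Record13CoPR`:
`Stage13RParams`, `.ZrUnity`, `.toStage5₁₃CoPR`, `Stage13RParams.ofRunBlind`, `Stage12Params.ZtUnity.ofRunBlind`, `Stage13RParams.toStage5₁₃CoPR_ofRunBlind`; from this seat's
`Node00/Record13DatumKeyCoPR`: the `CoPR`-keyed classes and `unityNondeg₁₃R ∕ unityNondeg₁₃R_iff`; REUSED BY NAME from `Node00/Record13DatumKey` (θ-level, proviso-free,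
background-free, residual-slot-free — NOT re-issued, cited at `θ.toStage13Params` by the consumers): `RateAssignment₁₃ ∕ SpineAssignment₁₃` and their lifts.  The key layer is
PROVISO-FIELD-BLIND, BACKGROUND-BLIND and RESIDUAL-SLOT-BLIND, which is why the re-key is a token map and every proof term of §1–§8 is the v1.5 proof term.

WHY THIS OBJECT (as at every edition).  ONE canonical parameter per datum, `h.params := Classical.choose h` of `h : IsDatumOfRecord₁₃CSepCoPR F N D` (`h.provisos`, `h.admissible`,
`h.eq_datumOfRecord₁₃SepCoPR`); keyed records COHERENT (`exists_keyed_canon₁₃SepCoPR_iff`, `keyed_canon₁₃SepCoPR_coherent`); `IsDatumOfRecord₁₃CSepCoPR.forall_params`;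
`isDatumOfRecord₁₃CSepCoPR_iff_exists_world` (the datum class IS def-T's `IsRecordOfRecord₁₃CSepCoPR` with the world forgotten); «`∃ D w, IsRecordOfRecord₁₃CSepCoPR F N D w`» REDUCES
HONESTLY to «one admissible `Stage13RParams` with every field of `Provisos₁₃SepCoPR` a theorem» (`exists_isDatumOfRecord₁₃CSepCoPR_iff_exists_params`) — INHABITATION IS NOT CLAIMED
HERE.  `IsRateKey₁₃SepCoPR F N D w θ` is `IsRecordOfRecord₁₃CSepCoPR`'s body with θ EXPOSED (`Iff.rfl`).  THE REGIME KEYS (§4–§6) and the CN KEYS (§7, guard `unityNondeg₁₃R N F θ :=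
θ.ZrUnity F N ∧ θ.SlotsNondegenerate₁₃ F N`, literal faces `isDatumOfRecord₁₃CSepCoPRN_iff`, `exists_isDatumOfRecord₁₃CSepCoPRN_iff_exists_params` (= K0⁶'s matrix read at `(F, 2)`
up to its node conjuncts), `forall_isRecordOfRecord₁₃CSepCoPRN_iff`) read exactly as at v1.5.

§8 THE ONE-WAY BRIDGE SepCoPR → CoPR (INTO `Node00/Record13DatumKeyCoPR`).  `Provisos₁₃SepCoPR → Provisos₁₃CoPR` IS a lemma (def-T's `.toCore`, forgetting the `bg` row) and the
datum AGREES by `rfl` (`datumOfRecord₁₃SepCoPR_eq_coPR`), so every `SepCoPR`-keyed class instance is a `CoPR`-keyed one at the SAME datum, parameter and world, one application of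
`h.toCore` each: `IsRateKey₁₃SepCoPR.toCoPR`, `IsDatumOfRecord₁₃CSepCoPR.toCoPR`, `IsDatumOfRecord₁₃CSepCoPROn.toCoPR`, `IsRecordOfRecord₁₃CSepCoPROn.toCoPR`,
`IsDatumOfRecord₁₃CSepCoPRN.toCoPR`, `IsRecordOfRecord₁₃CSepCoPRN.toCoPR` (the record-level `IsRecordOfRecord₁₃CSepCoPR.toCoPR` is def-T's).  Use: a rate ∕ spine HOME keyed ONCE on
`IsRecordOfRecord₁₃CCoPR[On]` ∕ `datumOfRecord₁₃CoPR` is applied at a rev-22 item's tuple `(θ, h : θ.Provisos₁₃SepCoPR F N)` as `… θ h.toCore …`, the datum by `rfl`; NO converse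
(`Provisos₁₃CoPR → Provisos₁₃SepCoPR` would assert a background-field bound from nothing).

§9 THE RUN-BLIND DOORS SepCoP → SepCoPR (NEW; ONE-WAY).  Along def-T's embedding `Stage13RParams.ofRunBlind` (FILE 26T §R2: `Stage13Params.Provisos₁₃SepCoP.ofRunBlind`,
`datumOfRecord₁₃SepCoPR_ofRunBlind` (`rfl`)) every v1.5 `SepCoP`-keyed class instance IS a v1.6 `SepCoPR`-keyed one AT THE SAME DATUM (and world): `IsDatumOfRecord₁₃CSepCoPR.ofCoP`,
`IsRateKey₁₃SepCoPR.ofCoP`, `IsDatumOfRecord₁₃CSepCoPROn.ofCoP ∕ IsRecordOfRecord₁₃CSepCoPROn.ofCoP` (given a regime transport), `IsDatumOfRecord₁₃CSepCoPRN.ofCoP ∕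
IsRecordOfRecord₁₃CSepCoPRN.ofCoP` — with def-T's record-level `IsRecordOfRecord₁₃CSepCoPR.ofCoP`, the whole of «K0⁶ ⇐ K0⁵» at class level (plan g69 Q4).  NO CONVERSE exists or
is claimed (FINDING №8: a run-indexed residual need not be run-blind); and, as at every edition, NO bridge from or to the ‴ ∕ ⁗ ∕ `SepMixed` ∕ `Co` ∕ `SepCo` keys is statable
(different data of record).

WHAT IS NOT HERE.  NO edit of any landed key module or consumer; NO `CoPR → SepCoPR`, NO `SepCoPR → SepCoP` bridge; NO `₁₂ ↔ ₁₃` key bridge; NO reading of any proviso row, of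
the background or of the residual slot `Zr`; NO inhabitant of any key; the θ-level assignments and the guard are NOT re-declared (imported by name); def-T's record predicate and its
faces are NOT re-declared; NO `Provisos₁₃SepCoPR` inhabitant and NO record is claimed to exist.

HONEST FRAMING.  Definitions of record + kernel bookkeeping (`Classical.choose`, `rfl`, `dite`, ∃-repackaging) — a typing-faithfulness re-key (FINDING №8) of a CONDITIONAL
finite-𝕋⁴ record at fixed `ε`; NOTHING of Bałaban's is asserted; NO inhabitant of any key is claimed (the record's inhabitation item K0⁶ is OPEN); no node is discharged;
counts unmoved (COUNT-NEUTRAL); one finite four-torus programme at fixed `ε` — NOT the continuum limit on ℝ⁴, NOT infinite volume, NOT OS, NOT a mass gap, NOT the Clay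
problem.  No `sorry` ∕ `axiom` ∕ `opaque` ∕ `instance` ∕ `notation`.  [Balaban1989LargeFieldII] = Commun. Math. Phys. **122** (1989) 355–392; [III] = [Balaban1988Convergent] =
Commun. Math. Phys. **119** (1988) 243–285; [Balaban1988RG2Cluster] = Commun. Math. Phys. **116** (1988) 1–22; [Balaban1987RG1] = Commun. Math. Phys. **109** (1987) 249–301;
[15] = [Balaban1985Variational] = Commun. Math. Phys. **102** (1985) 277–309 and [6] = [Balaban1985RegularSpaces] = Commun. Math. Phys. **99** (1985) 75–102 cited for
orientation only, nothing of them asserted.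
-/

noncomputable section

namespace Literature.MathematicalPhysics.QuantumFieldTheory.Balaban1983to89.Node00

open T4Continuum AveragingRT T4FiniteEpsInhabited FlowStep FlowStepRuns DagBinding T4DatumAssembly

/-! ## §1. «`D` is a datum of record, Stage 13» and its CANONICAL parameter -/

section DatumKey

variable (F : T4Family) (N : ℕ) [NeZero N]

/-- **«`D` is a datum of record, Stage 13 (C-class)»**: SOME admissible Stage-13 parameter tuple satisfying its displayed provisos has `D` as its datum of record — the
datum-level shadow of `IsRecordOfRecord₁₃CSepCoPR` (the world forgotten; `isDatumOfRecord₁₃CSepCoPR_iff_exists_world`). [cite: Balaban1989LargeFieldII, Thm 1 + (0.1) pp.355–356; Balaban1988Convergent, Thms 1–2 pp.262–263 (objects of record; bookkeeping)] -/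
def IsDatumOfRecord₁₃CSepCoPR (D : FiniteEpsData F (SU N)) : Prop :=
  ∃ (θ : Stage13RParams F N) (h : θ.Provisos₁₃SepCoPR F N), θ.Admissible F N ∧ D = datumOfRecord₁₃SepCoPR F N θ h

/-- Every admissible Stage-13 parameter tuple with provisos yields a datum of record. [cite: Balaban1989LargeFieldII, Thm 1 + (0.1) pp.355–356 (bookkeeping)] -/
theorem isDatumOfRecord₁₃CSepCoPR_datumOfRecord₁₃SepCoPR (θ : Stage13RParams F N) (h : θ.Provisos₁₃SepCoPR F N) (hθ : θ.Admissible F N) :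
    IsDatumOfRecord₁₃CSepCoPR F N (datumOfRecord₁₃SepCoPR F N θ h) :=
  ⟨θ, h, hθ, rfl⟩

/-- **K0′ READS THE SAME AT THE DATUM**: some datum of record exists at `(F, N)` iff some Stage-13 record pair `(D, w)` exists (the body of the route's K0′
`Record12Inhabited` at `N`). [cite: Balaban1989LargeFieldII, Thm 1 + (0.1) pp.355–356 (bookkeeping)] -/
theorem exists_isDatumOfRecord₁₃CSepCoPR_iff_exists_record :
    (∃ D : FiniteEpsData F (SU N), IsDatumOfRecord₁₃CSepCoPR F N D) ↔ ∃ (D : FiniteEpsData F (SU N)) (w : WorldP), IsRecordOfRecord₁₃CSepCoPR F N D w := by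
  constructor
  · rintro ⟨_, θ, hP, hθ, rfl⟩
    obtain ⟨w, hw, -⟩ := exists_world_isRecordOfRecord₁₃CSepCoPR F N θ hP hθ ⟨hθ.toStage9.gamma_pos, le_rfl⟩
    exact ⟨_, w, hw⟩
  · rintro ⟨D, w, hw⟩
    exact ⟨D, exists_provisos_of_isRecordOfRecord₁₃CSepCoPR hw⟩

/-- **THE HONEST REDUCTION OF K0′**: some datum of record exists at `(F, N)` iff SOME Stage-13 parameter tuple is admissible and satisfies every displayed proviso —
«exhibit ONE admissible `Stage13RParams` with EVERY proviso field a theorem» (the K0′ components); inhabitation is NOT claimed in this module.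
[cite: Balaban1988Convergent, (2.7) p.255, (2.21) p.258, (2.28) p.259, (3.16) p.268, (3.21) p.269; Balaban1987RG1, (1.12)–(1.15) p.262 (hypothesis dictionary; bookkeeping)] -/
theorem exists_isDatumOfRecord₁₃CSepCoPR_iff_exists_params :
    (∃ D : FiniteEpsData F (SU N), IsDatumOfRecord₁₃CSepCoPR F N D) ↔ ∃ θ : Stage13RParams F N, θ.Provisos₁₃SepCoPR F N ∧ θ.Admissible F N := by
  constructor
  · rintro ⟨_, θ, hP, hθ, -⟩
    exact ⟨θ, hP, hθ⟩
  · rintro ⟨θ, hP, hθ⟩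
    exact ⟨_, isDatumOfRecord₁₃CSepCoPR_datumOfRecord₁₃SepCoPR F N θ hP hθ⟩

variable {F N}
variable {D : FiniteEpsData F (SU N)} {w : WorldP}

/-- A Stage-13 record's datum is a Stage-13 datum of record. [cite: Balaban1989LargeFieldII, Thm 1 p.355 (bookkeeping)] -/
theorem isDatumOfRecord₁₃CSepCoPR_of_isRecordOfRecord₁₃CSepCoPR (h : IsRecordOfRecord₁₃CSepCoPR F N D w) : IsDatumOfRecord₁₃CSepCoPR F N D :=
  exists_provisos_of_isRecordOfRecord₁₃CSepCoPR h

/-- **DATUM OF RECORD ⟺ RECORD AT SOME WORLD.** [cite: Balaban1989LargeFieldII, Thm 1 + (0.1) pp.355–356 (bookkeeping)] -/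
theorem isDatumOfRecord₁₃CSepCoPR_iff_exists_world : IsDatumOfRecord₁₃CSepCoPR F N D ↔ ∃ w : WorldP, IsRecordOfRecord₁₃CSepCoPR F N D w := by
  constructor
  · rintro ⟨θ, hP, hθ, rfl⟩
    obtain ⟨w, hw, -⟩ := exists_world_isRecordOfRecord₁₃CSepCoPR F N θ hP hθ ⟨hθ.toStage9.gamma_pos, le_rfl⟩
    exact ⟨w, hw⟩
  · rintro ⟨w, hw⟩
    exact isDatumOfRecord₁₃CSepCoPR_of_isRecordOfRecord₁₃CSepCoPR hw

/-- **THE CANONICAL STAGE-13 PARAMETER OF A DATUM OF RECORD** (choice) — the ONE key both carrier records of clusters K4 ∕ K5 are read at.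
[cite: Balaban1989LargeFieldII, Thm 1 + (0.1) pp.355–356 (bookkeeping)] -/
def IsDatumOfRecord₁₃CSepCoPR.params (h : IsDatumOfRecord₁₃CSepCoPR F N D) : Stage13RParams F N :=
  Classical.choose h

/-- Its provisos. [cite: Balaban1988Convergent, (2.7) p.255, (2.21) p.258, (2.35) p.261 (bookkeeping)] -/
theorem IsDatumOfRecord₁₃CSepCoPR.provisos (h : IsDatumOfRecord₁₃CSepCoPR F N D) : h.params.Provisos₁₃SepCoPR F N :=
  (Classical.choose_spec h).fst

/-- Its admissibility. [cite: Balaban1987RG1, (1.12) p.262; Balaban1988Convergent, (2.10) p.256 (bookkeeping)] -/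
theorem IsDatumOfRecord₁₃CSepCoPR.admissible (h : IsDatumOfRecord₁₃CSepCoPR F N D) : h.params.Admissible F N :=
  (Classical.choose_spec h).snd.1

/-- **The datum IS the datum of record of its canonical parameter.** [cite: Balaban1989LargeFieldII, Thm 1 p.355 (bookkeeping)] -/
theorem IsDatumOfRecord₁₃CSepCoPR.eq_datumOfRecord₁₃SepCoPR (h : IsDatumOfRecord₁₃CSepCoPR F N D) : D = datumOfRecord₁₃SepCoPR F N h.params h.provisos :=
  (Classical.choose_spec h).snd.2

/-- The canonical parameter's coupling window is positive. [cite: Balaban1987RG1, (0.21) p.256 (bookkeeping)] -/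
theorem IsDatumOfRecord₁₃CSepCoPR.gamma_pos (h : IsDatumOfRecord₁₃CSepCoPR F N D) : 0 < h.params.γ :=
  h.admissible.toStage9.gamma_pos

/-- … and lies inside `]0, 1[` (the Stage-12 sign `γ < 1` of the tuple's Stage-12 admissibility). [cite: Balaban1988Convergent, (2.28) p.259 (bookkeeping)] -/
theorem IsDatumOfRecord₁₃CSepCoPR.gamma_lt_one (h : IsDatumOfRecord₁₃CSepCoPR F N D) : h.params.γ < 1 :=
  h.admissible.toStage12.pos₁₂.2.2.2.2

/-- **WHAT A CONSUMER PROVES ⟹ WHAT THE INSTANCE CARRIES**: a property of the objects of record established at EVERY admissible Stage-13 parameter tuple with provisos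
holds at the canonical parameter of every datum of record. [cite: Balaban1989LargeFieldII, Thm 1 p.355 (bookkeeping)] -/
theorem IsDatumOfRecord₁₃CSepCoPR.forall_params {P : (D : FiniteEpsData F (SU N)) → (θ : Stage13RParams F N) → θ.Provisos₁₃SepCoPR F N → Prop}
    (hP : ∀ (θ : Stage13RParams F N) (hθ : θ.Provisos₁₃SepCoPR F N), θ.Admissible F N → P (datumOfRecord₁₃SepCoPR F N θ hθ) θ hθ) (h : IsDatumOfRecord₁₃CSepCoPR F N D) :
    P D h.params h.provisos := by
  have := hP h.params h.provisos h.admissible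
  rwa [← h.eq_datumOfRecord₁₃SepCoPR] at this

/-- **WORLD COMPANION IN `₁₃C` AT ANY WINDOW BELOW THE CANONICAL ONE**: for `0 < γw ≤ h.params.γ` some world makes `(D, w)` a Stage-13 record with `w.γ = γw` — what
the N17 home-keying binder («`RRec … R → ∃ w, IsRecordOfRecord₁₃CSepCoPR F N D w ∧ R.u3.γ = w.γ`») consumes once `R.u3.γ` is pinned in that range.
[cite: Balaban1989LargeFieldII, Thm 1 + (0.1) pp.355–356 (bookkeeping)] -/
theorem IsDatumOfRecord₁₃CSepCoPR.exists_world (h : IsDatumOfRecord₁₃CSepCoPR F N D) {γw : ℝ} (hγw : 0 < γw ∧ γw ≤ h.params.γ) :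
    ∃ w : WorldP, IsRecordOfRecord₁₃CSepCoPR F N D w ∧ w.γ = γw := by
  obtain ⟨w, hw, hγ⟩ := exists_world_isRecordOfRecord₁₃CSepCoPR F N h.params h.provisos h.admissible hγw
  exact ⟨w, h.eq_datumOfRecord₁₃SepCoPR ▸ hw, hγ⟩

/-- … in particular at the canonical window `h.params.γ` itself. [cite: Balaban1989LargeFieldII, Thm 1 + (0.1) pp.355–356 (bookkeeping)] -/
theorem IsDatumOfRecord₁₃CSepCoPR.exists_world_gamma (h : IsDatumOfRecord₁₃CSepCoPR F N D) :
    ∃ w : WorldP, IsRecordOfRecord₁₃CSepCoPR F N D w ∧ w.γ = h.params.γ :=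
  h.exists_world ⟨h.gamma_pos, le_rfl⟩

/-- **THE DATUM's β-FUNCTIONS ARE THE STAGE-13 β OF RECORD AT THE CANONICAL PARAMETER** (def-T's `βfun_datumOfRecord₁₃SepCoPR`, `rfl` there; `betaOfRecord₁₃ F N θ` over
`Stage13RParams` is def-T's reducible name for the β of record re-based on the canonical-version transport and the (2.9)-species small-field function — NOT `betaOfRecord₁₀` of Stages 10–12: the histories of record differ, and there is
NO ₁₂ ↔ ₁₃ key bridge in this module) — what the (D4) read-out binders and node N17 read off `D`.
[cite: Balaban1987RG1, (1.20)–(1.22) p.264 (bookkeeping)] -/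
theorem IsDatumOfRecord₁₃CSepCoPR.βfun_eq_betaOfRecord₁₃ (h : IsDatumOfRecord₁₃CSepCoPR F N D) : D.βfun = betaOfRecord₁₃ F N h.params.toStage13Params := by
  have := βfun_datumOfRecord₁₃SepCoPR F N h.params h.provisos
  rwa [← h.eq_datumOfRecord₁₃SepCoPR] at this

/-- The datum's coupling flow of the run `p` IS the Stage-13 generated history of record of the canonical parameter (def-T's `flow_g_datumOfRecord₁₃SepCoPR`).
[cite: Balaban1987RG1, (0.17)–(0.20) pp.255–256 (bookkeeping)] -/
theorem IsDatumOfRecord₁₃CSepCoPR.flow_g (h : IsDatumOfRecord₁₃CSepCoPR F N D) (p : B12.RunParams) :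
    (D.C p).flow.g = gOfRecord₁₃ F N h.params.toStage13Params p := by
  have := flow_g_datumOfRecord₁₃SepCoPR F N h.params h.provisos p
  rwa [← h.eq_datumOfRecord₁₃SepCoPR] at this

/-- The datum's averaging maps ARE the averaging maps of record. [cite: Balaban1987RG1, (0.4) p.253 (bookkeeping)] -/
theorem IsDatumOfRecord₁₃CSepCoPR.av_eq (h : IsDatumOfRecord₁₃CSepCoPR F N D) : D.av = avOfRecord F N := by
  have := av_datumOfRecord₁₃SepCoPR F N h.params h.provisos
  rwa [← h.eq_datumOfRecord₁₃SepCoPR] at this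

/-- A Stage-13 datum of record is a datum of record, Stage 0 (binder B1 ∕ node N23's reading). [cite: Balaban1987RG1, (0.3)–(0.4) p.253 (bookkeeping)] -/
theorem IsDatumOfRecord₁₃CSepCoPR.isDatumOfRecord₀ (h : IsDatumOfRecord₁₃CSepCoPR F N D) : IsDatumOfRecord₀ F N D := by
  rw [h.eq_datumOfRecord₁₃SepCoPR]
  exact isDatumOfRecord₀_datumOfRecord₁₃SepCoPR F N h.params h.provisos

/-- N23 · binder B1 at every Stage-13 datum of record. [cite: Balaban1987RG1, (0.4) p.253] -/
theorem IsDatumOfRecord₁₃CSepCoPR.isPrintedAveraged (h : IsDatumOfRecord₁₃CSepCoPR F N D) : D.IsPrintedAveraged := by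
  rw [h.eq_datumOfRecord₁₃SepCoPR]
  exact isPrintedAveraged_datumOfRecord₁₃SepCoPR F N h.params h.provisos

/-- **THE ₅C SHADOW AT THE CANONICAL PARAMETER**: a Stage-13 datum of record is refined by a Stage-5 C-bound record at some world (def-T's
`exists_isRecordOfRecord₅C_of_isRecordOfRecord₁₃CSepCoPR` through the world companion) — for consumers keyed at ₅C. [cite: Balaban1989LargeFieldII, Thm 1 + (0.1) pp.355–356 (bookkeeping)] -/
theorem IsDatumOfRecord₁₃CSepCoPR.exists_isRecordOfRecord₅C (h : IsDatumOfRecord₁₃CSepCoPR F N D) :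
    ∃ (D₅ : FiniteEpsData F (SU N)) (w : WorldP), IsRecordOfRecord₅C F N D₅ w ∧ D₅.C = D.C ∧ (∀ K g₀ k, D₅.dens K g₀ k = D.dens K g₀ k) ∧
      D₅.βfun = D.βfun ∧ D₅.av = D.av := by
  obtain ⟨w, hw, -⟩ := h.exists_world_gamma
  obtain ⟨D₅, h₅⟩ := exists_isRecordOfRecord₅C_of_isRecordOfRecord₁₃CSepCoPR hw
  exact ⟨D₅, w, h₅⟩

end DatumKey

/-! ## §2. Canonicalised readings — COHERENCE for records keyed «`∃ θ hP, θ.Admissible F N ∧ D = datumOfRecord₁₃SepCoPR F N θ hP ∧ S = cr F θ hP …`»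

Reading an existentially keyed record through `canon₁₃SepCoPR f` makes the admitted bundle a function of the DATUM: `canon₁₃SepCoPR f θ hP = f h.params h.provisos` whenever
`datumOfRecord₁₃SepCoPR F N θ hP = D` and `h : IsDatumOfRecord₁₃CSepCoPR F N D` (`canon₁₃SepCoPR_eq_of_eq`), so two records keyed independently but read through `canon₁₃SepCoPR` admit, at the
same `(F, D, g₀, os)`, bundles read at the SAME parameter (`exists_keyed_canon₁₃SepCoPR_iff` turns either key into «`∃ h : IsDatumOfRecord₁₃CSepCoPR F N D, Φ (f h.params
h.provisos)`»).  Off the datum-of-record class `canon₁₃SepCoPR f = f`. -/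
section Canon

variable (F : T4Family) (N : ℕ) [NeZero N] {α : Sort*}

/-- **CANONICALISED READING**: read `f` at the canonical parameter of the datum `datumOfRecord₁₃SepCoPR F N θ hP` when that datum is of record (admissible), else at
`(θ, hP)` itself.  Kernel bookkeeping (`Classical.dec`, `dite`). [cite: Balaban1989LargeFieldII, Thm 1 + (0.1) pp.355–356 (bookkeeping)] -/
def canon₁₃SepCoPR (f : (θ : Stage13RParams F N) → θ.Provisos₁₃SepCoPR F N → α) (θ : Stage13RParams F N) (hP : θ.Provisos₁₃SepCoPR F N) : α := by
  classical
  exact if h : IsDatumOfRecord₁₃CSepCoPR F N (datumOfRecord₁₃SepCoPR F N θ hP) then f h.params h.provisos else f θ hP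

variable {F N}

/-- The canonical parameter depends on the datum only: transport of the key along `D = D'` does not change `.params` (proof irrelevance + `subst`).
[cite: Balaban1989LargeFieldII, Thm 1 + (0.1) pp.355–356 (bookkeeping)] -/
theorem IsDatumOfRecord₁₃CSepCoPR.params_congr {D D' : FiniteEpsData F (SU N)} (h : IsDatumOfRecord₁₃CSepCoPR F N D) (h' : IsDatumOfRecord₁₃CSepCoPR F N D') (e : D = D') :
    h.params = h'.params := by
  subst e
  rfl

/-- **`canon₁₃SepCoPR f θ hP = f h.params h.provisos`** whenever `(θ, hP)` realises a datum of record `D` with key `h`. [cite: Balaban1989LargeFieldII, Thm 1 + (0.1) pp.355–356 (bookkeeping)] -/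
theorem canon₁₃SepCoPR_eq_of_eq {f : (θ : Stage13RParams F N) → θ.Provisos₁₃SepCoPR F N → α} {D : FiniteEpsData F (SU N)} (h : IsDatumOfRecord₁₃CSepCoPR F N D)
    (θ : Stage13RParams F N) (hP : θ.Provisos₁₃SepCoPR F N) (e : D = datumOfRecord₁₃SepCoPR F N θ hP) :
    canon₁₃SepCoPR F N f θ hP = f h.params h.provisos := by
  subst e
  unfold canon₁₃SepCoPR
  rw [dif_pos h]

/-- At the canonical parameter itself `canon₁₃SepCoPR f` reads `f`. [cite: Balaban1989LargeFieldII, Thm 1 + (0.1) pp.355–356 (bookkeeping)] -/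
theorem canon₁₃SepCoPR_params {f : (θ : Stage13RParams F N) → θ.Provisos₁₃SepCoPR F N → α} {D : FiniteEpsData F (SU N)} (h : IsDatumOfRecord₁₃CSepCoPR F N D) :
    canon₁₃SepCoPR F N f h.params h.provisos = f h.params h.provisos :=
  canon₁₃SepCoPR_eq_of_eq h h.params h.provisos h.eq_datumOfRecord₁₃SepCoPR

/-- At an admissible tuple with provisos, `canon₁₃SepCoPR f` reads `f` at the canonical parameter of ITS datum. [cite: Balaban1989LargeFieldII, Thm 1 + (0.1) pp.355–356 (bookkeeping)] -/
theorem canon₁₃SepCoPR_eq_of_admissible {f : (θ : Stage13RParams F N) → θ.Provisos₁₃SepCoPR F N → α} (θ : Stage13RParams F N) (hP : θ.Provisos₁₃SepCoPR F N) (hθ : θ.Admissible F N) :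
    canon₁₃SepCoPR F N f θ hP = f (isDatumOfRecord₁₃CSepCoPR_datumOfRecord₁₃SepCoPR F N θ hP hθ).params (isDatumOfRecord₁₃CSepCoPR_datumOfRecord₁₃SepCoPR F N θ hP hθ).provisos :=
  canon₁₃SepCoPR_eq_of_eq _ θ hP rfl

/-- Off the datum-of-record class nothing is canonicalised. [cite: Balaban1989LargeFieldII, Thm 1 + (0.1) pp.355–356 (bookkeeping)] -/
theorem canon₁₃SepCoPR_eq_self_of_not {f : (θ : Stage13RParams F N) → θ.Provisos₁₃SepCoPR F N → α} (θ : Stage13RParams F N) (hP : θ.Provisos₁₃SepCoPR F N)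
    (hn : ¬ IsDatumOfRecord₁₃CSepCoPR F N (datumOfRecord₁₃SepCoPR F N θ hP)) : canon₁₃SepCoPR F N f θ hP = f θ hP := by
  unfold canon₁₃SepCoPR
  rw [dif_neg hn]

/-- **THE KEYED-RECORD FACE**: an existentially keyed record («some admissible `θ` with provisos realises `D` and the bundle reads `canon₁₃SepCoPR f` there») IS the
datum-keyed record («the bundle reads `f` at the canonical parameter of `D`») — for every property `Φ` of the reading (e.g. `Φ x := S = x g₀ os`).  This is the
sentence that makes (T-SPINE)'s and (T-RATE)'s Stage-13 records COHERENT. [cite: Balaban1989LargeFieldII, Thm 1 + (0.1) pp.355–356 (bookkeeping)] -/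
theorem exists_keyed_canon₁₃SepCoPR_iff {f : (θ : Stage13RParams F N) → θ.Provisos₁₃SepCoPR F N → α} {D : FiniteEpsData F (SU N)} (Φ : α → Prop) :
    (∃ (θ : Stage13RParams F N) (hP : θ.Provisos₁₃SepCoPR F N), θ.Admissible F N ∧ D = datumOfRecord₁₃SepCoPR F N θ hP ∧ Φ (canon₁₃SepCoPR F N f θ hP)) ↔
      ∃ h : IsDatumOfRecord₁₃CSepCoPR F N D, Φ (f h.params h.provisos) := by
  constructor
  · rintro ⟨θ, hP, hθ, e, hΦ⟩
    have h : IsDatumOfRecord₁₃CSepCoPR F N D := ⟨θ, hP, hθ, e⟩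
    refine ⟨h, ?_⟩
    rwa [canon₁₃SepCoPR_eq_of_eq (f := f) h θ hP e] at hΦ
  · rintro ⟨h, hΦ⟩
    refine ⟨h.params, h.provisos, h.admissible, h.eq_datumOfRecord₁₃SepCoPR, ?_⟩
    rwa [canon₁₃SepCoPR_params (f := f) h]

/-- **COHERENCE**: two existentially keyed records read through `canon₁₃SepCoPR` admit, at the same datum, readings AT THE SAME PARAMETER.
[cite: Balaban1989LargeFieldII, Thm 1 + (0.1) pp.355–356 (bookkeeping)] -/
theorem keyed_canon₁₃SepCoPR_coherent {β : Sort*} {f : (θ : Stage13RParams F N) → θ.Provisos₁₃SepCoPR F N → α} {g : (θ : Stage13RParams F N) → θ.Provisos₁₃SepCoPR F N → β}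
    {D : FiniteEpsData F (SU N)} (Φ : α → Prop) (Ψ : β → Prop)
    (hΦ : ∃ (θ : Stage13RParams F N) (hP : θ.Provisos₁₃SepCoPR F N), θ.Admissible F N ∧ D = datumOfRecord₁₃SepCoPR F N θ hP ∧ Φ (canon₁₃SepCoPR F N f θ hP))
    (hΨ : ∃ (θ : Stage13RParams F N) (hP : θ.Provisos₁₃SepCoPR F N), θ.Admissible F N ∧ D = datumOfRecord₁₃SepCoPR F N θ hP ∧ Ψ (canon₁₃SepCoPR F N g θ hP)) :
    ∃ h : IsDatumOfRecord₁₃CSepCoPR F N D, Φ (f h.params h.provisos) ∧ Ψ (g h.params h.provisos) := by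
  obtain ⟨h, h₁⟩ := (exists_keyed_canon₁₃SepCoPR_iff Φ).1 hΦ
  obtain ⟨h', h₂⟩ := (exists_keyed_canon₁₃SepCoPR_iff Ψ).1 hΨ
  exact ⟨h, h₁, h₂⟩

end Canon

/-! ## §3. The θ-exposed Stage-13 record key `IsRateKey₁₃SepCoPR` and the residual ASSIGNMENTS of the rate-record home at Stage 13 (`RateAssignment₁₃` ∕ `SpineAssignment₁₃` over
`Stage13RParams`, with the one-token lifts `.ofStage12` ∕ `.ofStage9` of the Stage-12 ∕ Stage-9-typed assignments; RR-1's object containers BY NAME) -/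

section Key

variable (F : T4Family) (N : ℕ) [NeZero N]

/-- **«(D, w) is the Stage-13 record WITH PARAMETERS θ»**: the body of `IsRecordOfRecord₁₃CSepCoPR F N D w` with the Stage-13 parameter tuple EXPOSED — θ is admissible and
satisfies its displayed provisos, its datum of record IS `D`, and the world `w` is bound to the construction with a window `0 < w.γ ≤ θ.γ`, Bałaban's block size and
the C-binding of record over the Stage-13 view. [cite: Balaban1989LargeFieldII, Thm 1 + (0.1) pp.355–356; Balaban1987RG1, (0.24)–(0.25) p.257 (objects of record; bookkeeping)] -/
def IsRateKey₁₃SepCoPR (D : FiniteEpsData F (SU N)) (w : WorldP) (θ : Stage13RParams F N) : Prop :=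
  ∃ h : θ.Provisos₁₃SepCoPR F N, θ.Admissible F N ∧ D = datumOfRecord₁₃SepCoPR F N θ h ∧ w.C = D.C ∧ (0 < w.γ ∧ w.γ ≤ θ.γ) ∧
    w.L = (θ.L : ℝ) ∧ ∀ P : B12.RunParams, w.up P = upOfRecord₅C F N (θ.toStage5₁₃CoPR F N) P

/-- **A Stage-13 record IS a keyed record for SOME θ, and conversely** (`Iff.rfl`: the key is `IsRecordOfRecord₁₃CSepCoPR`'s body). [cite: Balaban1989LargeFieldII, Thm 1 + (0.1) pp.355–356 (bookkeeping)] -/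
theorem isRecordOfRecord₁₃CSepCoPR_iff_exists_isRateKey₁₃SepCoPR (D : FiniteEpsData F (SU N)) (w : WorldP) :
    IsRecordOfRecord₁₃CSepCoPR F N D w ↔ ∃ θ : Stage13RParams F N, IsRateKey₁₃SepCoPR F N D w θ := Iff.rfl

/-- **Pointed form of the key** at the datum of record. [cite: Balaban1989LargeFieldII, Thm 1 + (0.1) pp.355–356 (bookkeeping)] -/
theorem isRateKey₁₃SepCoPR_of_eq (θ : Stage13RParams F N) (h : θ.Provisos₁₃SepCoPR F N) (hθ : θ.Admissible F N) (w : WorldP)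
    (hC : w.C = (datumOfRecord₁₃SepCoPR F N θ h).C) (hγ : 0 < w.γ ∧ w.γ ≤ θ.γ) (hL : w.L = (θ.L : ℝ))
    (hup : ∀ P, w.up P = upOfRecord₅C F N (θ.toStage5₁₃CoPR F N) P) :
    IsRateKey₁₃SepCoPR F N (datumOfRecord₁₃SepCoPR F N θ h) w θ :=
  ⟨h, hθ, rfl, hC, hγ, hL, hup⟩

/-- **Every admissible θ satisfying its provisos is keyed at some world with any window `0 < γw ≤ θ.γ`** — inhabitation of the keyed class is Stage 13's exactly.
[cite: Balaban1989LargeFieldII, Thm 1 + (0.1) pp.355–356 (bookkeeping)] -/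
theorem exists_world_isRateKey₁₃SepCoPR (θ : Stage13RParams F N) (h : θ.Provisos₁₃SepCoPR F N) (hθ : θ.Admissible F N) {γw : ℝ} (hγw : 0 < γw ∧ γw ≤ θ.γ) :
    ∃ w : WorldP, IsRateKey₁₃SepCoPR F N (datumOfRecord₁₃SepCoPR F N θ h) w θ ∧ w.γ = γw := by
  obtain ⟨w₀⟩ := nonempty_worldP
  exact ⟨{ w₀ with
      C := (datumOfRecord₁₃SepCoPR F N θ h).C, γ := γw, L := (θ.L : ℝ), one_lt_L := by exact_mod_cast θ.hL.2,
      up := fun P => upOfRecord₅C F N (θ.toStage5₁₃CoPR F N) P },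
    ⟨h, hθ, rfl, rfl, hγw, rfl, fun _ => rfl⟩, rfl⟩

variable {F N}
variable {D : FiniteEpsData F (SU N)} {w : WorldP} {θ : Stage13RParams F N}

/-- A keyed record is a Stage-13 record. [cite: Balaban1989LargeFieldII, Thm 1 + (0.1) pp.355–356 (bookkeeping)] -/
theorem IsRateKey₁₃SepCoPR.isRecordOfRecord₁₃CSepCoPR (hk : IsRateKey₁₃SepCoPR F N D w θ) : IsRecordOfRecord₁₃CSepCoPR F N D w := ⟨θ, hk⟩

/-- … hence its datum is a Stage-13 datum of record. [cite: Balaban1989LargeFieldII, Thm 1 p.355 (bookkeeping)] -/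
theorem IsRateKey₁₃SepCoPR.isDatumOfRecord₁₃CSepCoPR (hk : IsRateKey₁₃SepCoPR F N D w θ) : IsDatumOfRecord₁₃CSepCoPR F N D :=
  isDatumOfRecord₁₃CSepCoPR_of_isRecordOfRecord₁₃CSepCoPR hk.isRecordOfRecord₁₃CSepCoPR

/-- The key CERTIFIES θ's provisos and admissibility and realises `D` as θ's datum of record. [cite: Balaban1989LargeFieldI, (0.3)–(0.4) p.176 (bookkeeping)] -/
theorem IsRateKey₁₃SepCoPR.exists_provisos (hk : IsRateKey₁₃SepCoPR F N D w θ) : ∃ h : θ.Provisos₁₃SepCoPR F N, θ.Admissible F N ∧ D = datumOfRecord₁₃SepCoPR F N θ h := by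
  obtain ⟨h, hθ, hD, -⟩ := hk
  exact ⟨h, hθ, hD⟩

/-- The key's θ is admissible. [cite: Balaban1987RG1, (1.20)–(1.21) p.264 (hypothesis dictionary; bookkeeping)] -/
theorem IsRateKey₁₃SepCoPR.admissible (hk : IsRateKey₁₃SepCoPR F N D w θ) : θ.Admissible F N := by
  obtain ⟨-, hθ, -⟩ := hk
  exact hθ

/-- The world's window is positive. [cite: Balaban1987RG1, Thm 1 p.259 (bookkeeping)] -/
theorem IsRateKey₁₃SepCoPR.gamma_pos (hk : IsRateKey₁₃SepCoPR F N D w θ) : 0 < w.γ := by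
  obtain ⟨-, -, -, -, hγ, -⟩ := hk
  exact hγ.1

/-- The world's window sits inside θ's coupling window: `w.γ ≤ θ.γ`. [cite: Balaban1987RG1, Thm 1 p.259 (bookkeeping)] -/
theorem IsRateKey₁₃SepCoPR.gamma_le (hk : IsRateKey₁₃SepCoPR F N D w θ) : w.γ ≤ θ.γ := by
  obtain ⟨-, -, -, -, hγ, -⟩ := hk
  exact hγ.2

/-- The world reads θ's block factor. [cite: Balaban1987RG1, (0.1) p.251 (bookkeeping)] -/
theorem IsRateKey₁₃SepCoPR.L_eq (hk : IsRateKey₁₃SepCoPR F N D w θ) : w.L = (θ.L : ℝ) := by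
  obtain ⟨-, -, -, -, -, hL, -⟩ := hk
  exact hL

/-- The world is bound to the datum's construction. [cite: Balaban1989LargeFieldII, Thm 1 + (0.1) pp.355–356 (bookkeeping)] -/
theorem IsRateKey₁₃SepCoPR.construction_eq (hk : IsRateKey₁₃SepCoPR F N D w θ) : w.C = D.C := by
  obtain ⟨-, -, -, hC, -⟩ := hk
  exact hC

/-- The upstream block of the world is the C-binding of record at the Stage-13 view. [cite: Balaban1989LargeFieldII, Thm 1 + (0.1) pp.355–356 (bookkeeping)] -/
theorem IsRateKey₁₃SepCoPR.up_eq (hk : IsRateKey₁₃SepCoPR F N D w θ) (P : B12.RunParams) : w.up P = upOfRecord₅C F N (θ.toStage5₁₃CoPR F N) P := by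
  obtain ⟨-, -, -, -, -, -, hup⟩ := hk
  exact hup P

end Key


/-! ## §4. «`D` is a datum of record, Stage 13, realised IN THE REGIME `Rg`» and its canonical parameter in the regime -/

section DatumKeyOn

variable (F : T4Family) (N : ℕ) [NeZero N]

/-- **«`D` is a datum of record, Stage 13, realised in the regime `Rg`»**: SOME admissible Stage-13 parameter tuple IN `Rg` satisfying its displayed provisos has `D` as its datum
of record — the common key prefix of the regime-restricted carrier homes (the Stage-13 re-keys of `YMDAG.UVSplit.RRec₁₂On 𝔯 Rg` ∕ `SRec₁₂On cr Rg`).  At `Rg := ⊤` it is the C key (`isDatumOfRecord₁₃CSepCoPROn_true_iff`).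
[cite: Balaban1989LargeFieldII, Thm 1 + (0.1) pp.355–356; Balaban1988Convergent, Thms 1–2 pp.262–263 (objects of record; bookkeeping)] -/
def IsDatumOfRecord₁₃CSepCoPROn (Rg : (F : T4Family) → Stage13RParams F N → Prop) (D : FiniteEpsData F (SU N)) : Prop :=
  ∃ (θ : Stage13RParams F N) (h : θ.Provisos₁₃SepCoPR F N), Rg F θ ∧ θ.Admissible F N ∧ D = datumOfRecord₁₃SepCoPR F N θ h

variable (Rg : (F : T4Family) → Stage13RParams F N → Prop)

/-- Unfolding (`Iff.rfl`). [cite: Balaban1989LargeFieldII, Thm 1 + (0.1) pp.355–356 (bookkeeping)] -/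
theorem isDatumOfRecord₁₃CSepCoPROn_iff (D : FiniteEpsData F (SU N)) :
    IsDatumOfRecord₁₃CSepCoPROn F N Rg D ↔ ∃ (θ : Stage13RParams F N) (h : θ.Provisos₁₃SepCoPR F N), Rg F θ ∧ θ.Admissible F N ∧ D = datumOfRecord₁₃SepCoPR F N θ h :=
  Iff.rfl

/-- Every admissible Stage-13 parameter tuple in the regime with provisos yields a datum of record in the regime. [cite: Balaban1989LargeFieldII, Thm 1 + (0.1) pp.355–356 (bookkeeping)] -/
theorem isDatumOfRecord₁₃CSepCoPROn_datumOfRecord₁₃SepCoPR (θ : Stage13RParams F N) (h : θ.Provisos₁₃SepCoPR F N) (hRg : Rg F θ) (hθ : θ.Admissible F N) :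
    IsDatumOfRecord₁₃CSepCoPROn F N Rg (datumOfRecord₁₃SepCoPR F N θ h) :=
  ⟨θ, h, hRg, hθ, rfl⟩

/-- **THE HONEST REDUCTION, IN THE REGIME**: some datum of record in `Rg` exists at `(F, N)` iff SOME Stage-13 parameter tuple satisfies every displayed proviso, lies in `Rg` and
is admissible; inhabitation is NOT claimed in this module. [cite: Balaban1988Convergent, (2.7) p.255, (2.21) p.258, (3.16)–(3.22) pp.268–269; Balaban1987RG1, (1.12)–(1.15) p.262 (hypothesis dictionary; bookkeeping)] -/
theorem exists_isDatumOfRecord₁₃CSepCoPROn_iff_exists_params :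
    (∃ D : FiniteEpsData F (SU N), IsDatumOfRecord₁₃CSepCoPROn F N Rg D) ↔ ∃ θ : Stage13RParams F N, θ.Provisos₁₃SepCoPR F N ∧ Rg F θ ∧ θ.Admissible F N := by
  constructor
  · rintro ⟨_, θ, hP, hRg, hθ, -⟩
    exact ⟨θ, hP, hRg, hθ⟩
  · rintro ⟨θ, hP, hRg, hθ⟩
    exact ⟨_, isDatumOfRecord₁₃CSepCoPROn_datumOfRecord₁₃SepCoPR F N Rg θ hP hRg hθ⟩

/-- **A PROPERTY OF EVERY DATUM OF RECORD IN THE REGIME ⟺ THE θ-KEYED SENTENCE GUARDED BY `Rg`** (datum level). [cite: Balaban1989LargeFieldII, Thm 1 + (0.1) pp.355–356 (bookkeeping)] -/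
theorem forall_isDatumOfRecord₁₃CSepCoPROn_iff (P : FiniteEpsData F (SU N) → Prop) :
    (∀ D : FiniteEpsData F (SU N), IsDatumOfRecord₁₃CSepCoPROn F N Rg D → P D) ↔
      ∀ (θ : Stage13RParams F N) (h : θ.Provisos₁₃SepCoPR F N), Rg F θ → θ.Admissible F N → P (datumOfRecord₁₃SepCoPR F N θ h) := by
  constructor
  · intro hall θ h hRg hθ
    exact hall _ (isDatumOfRecord₁₃CSepCoPROn_datumOfRecord₁₃SepCoPR F N Rg θ h hRg hθ)
  · rintro hall D ⟨θ, h, hRg, hθ, rfl⟩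
    exact hall θ h hRg hθ

variable {F N Rg}
variable {D : FiniteEpsData F (SU N)}

/-- The regime forgotten: a datum of record in `Rg` is a datum of record (C key). [cite: Balaban1989LargeFieldII, Thm 1 p.355 (bookkeeping)] -/
theorem IsDatumOfRecord₁₃CSepCoPROn.toC (h : IsDatumOfRecord₁₃CSepCoPROn F N Rg D) : IsDatumOfRecord₁₃CSepCoPR F N D := by
  obtain ⟨θ, hP, -, hθ, hD⟩ := h
  exact ⟨θ, hP, hθ, hD⟩

/-- Monotone in the regime. [cite: Balaban1989LargeFieldII, Thm 1 p.355 (bookkeeping)] -/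
theorem IsDatumOfRecord₁₃CSepCoPROn.mono {Rg' : (F : T4Family) → Stage13RParams F N → Prop} (hle : ∀ (F : T4Family) (θ : Stage13RParams F N), Rg F θ → Rg' F θ)
    (h : IsDatumOfRecord₁₃CSepCoPROn F N Rg D) : IsDatumOfRecord₁₃CSepCoPROn F N Rg' D := by
  obtain ⟨θ, hP, hRg, hθ, hD⟩ := h
  exact ⟨θ, hP, hle F θ hRg, hθ, hD⟩

/-- At the trivial regime the key IS the C key. [cite: Balaban1989LargeFieldII, Thm 1 p.355 (bookkeeping)] -/
theorem isDatumOfRecord₁₃CSepCoPROn_true_iff : IsDatumOfRecord₁₃CSepCoPROn F N (fun _ _ => True) D ↔ IsDatumOfRecord₁₃CSepCoPR F N D :=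
  ⟨fun h => h.toC, fun ⟨θ, hP, hθ, hD⟩ => ⟨θ, hP, trivial, hθ, hD⟩⟩

/-- A datum of record whose C-CANONICAL parameter lies in the regime is a datum of record in the regime (companion of the (T-RATE) home's `rRec₁₂On_of_regime_params`, re-keyed).
[cite: Balaban1989LargeFieldII, Thm 1 p.355 (bookkeeping)] -/
theorem IsDatumOfRecord₁₃CSepCoPR.isDatumOfRecord₁₃CSepCoPROn_of_regime_params (h : IsDatumOfRecord₁₃CSepCoPR F N D) (hRg : Rg F h.params) : IsDatumOfRecord₁₃CSepCoPROn F N Rg D :=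
  ⟨h.params, h.provisos, hRg, h.admissible, h.eq_datumOfRecord₁₃SepCoPR⟩

/-- **THE CANONICAL STAGE-13 PARAMETER OF A DATUM OF RECORD IN THE REGIME** (choice).  HONEST: it need not equal the C-canonical parameter `h.toC.params` of the same datum
(two choices over two existentials); the regime reaches THIS parameter (`.regime`), never `IsDatumOfRecord₁₃CSepCoPR.params`. [cite: Balaban1989LargeFieldII, Thm 1 + (0.1) pp.355–356 (bookkeeping)] -/
def IsDatumOfRecord₁₃CSepCoPROn.params (h : IsDatumOfRecord₁₃CSepCoPROn F N Rg D) : Stage13RParams F N :=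
  Classical.choose h

/-- Its provisos. [cite: Balaban1988Convergent, (2.7) p.255, (2.21) p.258, (2.35) p.261 (bookkeeping)] -/
theorem IsDatumOfRecord₁₃CSepCoPROn.provisos (h : IsDatumOfRecord₁₃CSepCoPROn F N Rg D) : h.params.Provisos₁₃SepCoPR F N :=
  (Classical.choose_spec h).fst

/-- **It lies IN THE REGIME.** [cite: Balaban1988Convergent, (3.16)–(3.22) pp.268–269 (bookkeeping)] -/
theorem IsDatumOfRecord₁₃CSepCoPROn.regime (h : IsDatumOfRecord₁₃CSepCoPROn F N Rg D) : Rg F h.params :=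
  (Classical.choose_spec h).snd.1

/-- Its admissibility. [cite: Balaban1987RG1, (1.12) p.262; Balaban1988Convergent, (2.10) p.256 (bookkeeping)] -/
theorem IsDatumOfRecord₁₃CSepCoPROn.admissible (h : IsDatumOfRecord₁₃CSepCoPROn F N Rg D) : h.params.Admissible F N :=
  (Classical.choose_spec h).snd.2.1

/-- **The datum IS the datum of record of its canonical parameter in the regime.** [cite: Balaban1989LargeFieldII, Thm 1 p.355 (bookkeeping)] -/
theorem IsDatumOfRecord₁₃CSepCoPROn.eq_datumOfRecord₁₃SepCoPR (h : IsDatumOfRecord₁₃CSepCoPROn F N Rg D) : D = datumOfRecord₁₃SepCoPR F N h.params h.provisos :=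
  (Classical.choose_spec h).snd.2.2

/-- The canonical parameter realises a C-datum key of `D` (pointed form; its `.params` is NOT asserted to be `h.params`). [cite: Balaban1989LargeFieldII, Thm 1 p.355 (bookkeeping)] -/
theorem IsDatumOfRecord₁₃CSepCoPROn.isDatumOfRecord₁₃CSepCoPR_params (h : IsDatumOfRecord₁₃CSepCoPROn F N Rg D) :
    IsDatumOfRecord₁₃CSepCoPR F N (datumOfRecord₁₃SepCoPR F N h.params h.provisos) :=
  isDatumOfRecord₁₃CSepCoPR_datumOfRecord₁₃SepCoPR F N h.params h.provisos h.admissible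

/-- The canonical parameter's coupling window is positive. [cite: Balaban1987RG1, (0.21) p.256 (bookkeeping)] -/
theorem IsDatumOfRecord₁₃CSepCoPROn.gamma_pos (h : IsDatumOfRecord₁₃CSepCoPROn F N Rg D) : 0 < h.params.γ :=
  h.admissible.toStage9.gamma_pos

/-- … and lies inside `]0, 1[`. [cite: Balaban1988Convergent, (2.28) p.259 (bookkeeping)] -/
theorem IsDatumOfRecord₁₃CSepCoPROn.gamma_lt_one (h : IsDatumOfRecord₁₃CSepCoPROn F N Rg D) : h.params.γ < 1 :=
  h.admissible.toStage12.pos₁₂.2.2.2.2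

/-- The canonical parameter in the regime depends on the datum only. [cite: Balaban1989LargeFieldII, Thm 1 + (0.1) pp.355–356 (bookkeeping)] -/
theorem IsDatumOfRecord₁₃CSepCoPROn.params_congr {D' : FiniteEpsData F (SU N)} (h : IsDatumOfRecord₁₃CSepCoPROn F N Rg D) (h' : IsDatumOfRecord₁₃CSepCoPROn F N Rg D') (e : D = D') :
    h.params = h'.params := by
  subst e
  rfl

/-- **WHAT A CONSUMER PROVES IN THE REGIME ⟹ WHAT THE INSTANCE CARRIES**: a property of the objects of record established at EVERY admissible Stage-13 parameter tuple IN `Rg` with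
provisos holds at the canonical parameter in the regime of every datum of record in the regime — the regime is AVAILABLE as a hypothesis. [cite: Balaban1989LargeFieldII, Thm 1 p.355 (bookkeeping)] -/
theorem IsDatumOfRecord₁₃CSepCoPROn.forall_params {P : (D : FiniteEpsData F (SU N)) → (θ : Stage13RParams F N) → θ.Provisos₁₃SepCoPR F N → Prop}
    (hP : ∀ (θ : Stage13RParams F N) (hθ : θ.Provisos₁₃SepCoPR F N), Rg F θ → θ.Admissible F N → P (datumOfRecord₁₃SepCoPR F N θ hθ) θ hθ) (h : IsDatumOfRecord₁₃CSepCoPROn F N Rg D) :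
    P D h.params h.provisos := by
  have := hP h.params h.provisos h.regime h.admissible
  rwa [← h.eq_datumOfRecord₁₃SepCoPR] at this

/-- The datum's β-functions are the Stage-13 β of record at the canonical parameter. [cite: Balaban1987RG1, (1.20)–(1.22) p.264 (bookkeeping)] -/
theorem IsDatumOfRecord₁₃CSepCoPROn.βfun_eq_betaOfRecord₁₃ (h : IsDatumOfRecord₁₃CSepCoPROn F N Rg D) : D.βfun = betaOfRecord₁₃ F N h.params.toStage13Params := by
  have := βfun_datumOfRecord₁₃SepCoPR F N h.params h.provisos
  rwa [← h.eq_datumOfRecord₁₃SepCoPR] at this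

/-- The datum's coupling flow of the run `p` IS the Stage-13 generated history of record of the canonical parameter. [cite: Balaban1987RG1, (0.17)–(0.20) pp.255–256 (bookkeeping)] -/
theorem IsDatumOfRecord₁₃CSepCoPROn.flow_g (h : IsDatumOfRecord₁₃CSepCoPROn F N Rg D) (p : B12.RunParams) :
    (D.C p).flow.g = gOfRecord₁₃ F N h.params.toStage13Params p := by
  have := flow_g_datumOfRecord₁₃SepCoPR F N h.params h.provisos p
  rwa [← h.eq_datumOfRecord₁₃SepCoPR] at this

/-- A datum of record in the regime is a datum of record, Stage 0. [cite: Balaban1987RG1, (0.3)–(0.4) p.253 (bookkeeping)] -/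
theorem IsDatumOfRecord₁₃CSepCoPROn.isDatumOfRecord₀ (h : IsDatumOfRecord₁₃CSepCoPROn F N Rg D) : IsDatumOfRecord₀ F N D :=
  h.toC.isDatumOfRecord₀


end DatumKeyOn

/-! ## §5. «`(D, w)` is a Stage-13 record realised IN THE REGIME `Rg`»; world companions; the θ-keyed guarded junction -/

section RecordKeyOn

variable (F : T4Family) (N : ℕ) [NeZero N]

/-- **«`(D, w)` is a Stage-13 record (C-class) realised in the regime `Rg`»**: `IsRecordOfRecord₁₃CSepCoPR F N D w`'s body (the θ-exposed key `IsRateKey₁₃SepCoPR`) with the parameter IN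
`Rg` — the regime-restricted record class a guarded composer quantifies over (`Spine`, `S_R00x`, `S_N27x` at `fun F D w => IsRecordOfRecord₁₃CSepCoPROn F N Rg D w`).  At `Rg := ⊤` it is
`IsRecordOfRecord₁₃CSepCoPR` (`isRecordOfRecord₁₃CSepCoPROn_true_iff`). [cite: Balaban1989LargeFieldII, Thm 1 + (0.1) pp.355–356; Balaban1987RG1, (0.24)–(0.25) p.257 (objects of record; bookkeeping)] -/
def IsRecordOfRecord₁₃CSepCoPROn (Rg : (F : T4Family) → Stage13RParams F N → Prop) (D : FiniteEpsData F (SU N)) (w : WorldP) : Prop :=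
  ∃ θ : Stage13RParams F N, Rg F θ ∧ IsRateKey₁₃SepCoPR F N D w θ

variable (Rg : (F : T4Family) → Stage13RParams F N → Prop)

/-- Unfolding (`Iff.rfl`). [cite: Balaban1989LargeFieldII, Thm 1 + (0.1) pp.355–356 (bookkeeping)] -/
theorem isRecordOfRecord₁₃CSepCoPROn_iff (D : FiniteEpsData F (SU N)) (w : WorldP) :
    IsRecordOfRecord₁₃CSepCoPROn F N Rg D w ↔ ∃ θ : Stage13RParams F N, Rg F θ ∧ IsRateKey₁₃SepCoPR F N D w θ :=
  Iff.rfl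

/-- **Every admissible θ in the regime with provisos is a record in the regime at some world with any window `0 < γw ≤ θ.γ`.** [cite: Balaban1989LargeFieldII, Thm 1 + (0.1) pp.355–356 (bookkeeping)] -/
theorem exists_world_isRecordOfRecord₁₃CSepCoPROn (θ : Stage13RParams F N) (h : θ.Provisos₁₃SepCoPR F N) (hRg : Rg F θ) (hθ : θ.Admissible F N) {γw : ℝ}
    (hγw : 0 < γw ∧ γw ≤ θ.γ) : ∃ w : WorldP, IsRecordOfRecord₁₃CSepCoPROn F N Rg (datumOfRecord₁₃SepCoPR F N θ h) w ∧ w.γ = γw := by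
  obtain ⟨w, hk, hγ⟩ := exists_world_isRateKey₁₃SepCoPR F N θ h hθ hγw
  exact ⟨w, ⟨θ, hRg, hk⟩, hγ⟩

/-- Some datum of record in the regime exists iff some record in the regime exists. [cite: Balaban1989LargeFieldII, Thm 1 + (0.1) pp.355–356 (bookkeeping)] -/
theorem exists_isDatumOfRecord₁₃CSepCoPROn_iff_exists_record :
    (∃ D : FiniteEpsData F (SU N), IsDatumOfRecord₁₃CSepCoPROn F N Rg D) ↔ ∃ (D : FiniteEpsData F (SU N)) (w : WorldP), IsRecordOfRecord₁₃CSepCoPROn F N Rg D w := by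
  constructor
  · rintro ⟨_, θ, hP, hRg, hθ, rfl⟩
    obtain ⟨w, hw, -⟩ := exists_world_isRecordOfRecord₁₃CSepCoPROn F N Rg θ hP hRg hθ ⟨hθ.toStage9.gamma_pos, le_rfl⟩
    exact ⟨_, w, hw⟩
  · rintro ⟨D, w, θ, hRg, hk⟩
    obtain ⟨hP, hθ, hD⟩ := hk.exists_provisos
    exact ⟨D, θ, hP, hRg, hθ, hD⟩

/-- **A WORLD-BLIND PROPERTY AT EVERY RECORD IN THE REGIME ⟺ THE θ-KEYED SENTENCE GUARDED BY `Rg`** — the junction between a composer's conclusion over the regime-restricted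
record class (e.g. `YMDAG.UVSplit.Spine` at `IsRecordOfRecord₁₃CSepCoPROn F N Rg`) and an item text «`∀ θ (h : θ.Provisos₁₃SepCoPR F N), Rg F θ → θ.Admissible F N → P (datumOfRecord₁₃SepCoPR F N θ h)`».
[cite: Balaban1989LargeFieldII, Thm 1 + (0.1) pp.355–356 (bookkeeping)] -/
theorem forall_isRecordOfRecord₁₃CSepCoPROn_iff (P : FiniteEpsData F (SU N) → Prop) :
    (∀ (D : FiniteEpsData F (SU N)) (w : WorldP), IsRecordOfRecord₁₃CSepCoPROn F N Rg D w → P D) ↔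
      ∀ (θ : Stage13RParams F N) (h : θ.Provisos₁₃SepCoPR F N), Rg F θ → θ.Admissible F N → P (datumOfRecord₁₃SepCoPR F N θ h) := by
  constructor
  · intro hall θ h hRg hθ
    obtain ⟨w, hw, -⟩ := exists_world_isRecordOfRecord₁₃CSepCoPROn F N Rg θ h hRg hθ ⟨hθ.toStage9.gamma_pos, le_rfl⟩
    exact hall _ w hw
  · rintro hall D w ⟨θ, hRg, hk⟩
    obtain ⟨h, hθ, rfl⟩ := hk.exists_provisos
    exact hall θ h hRg hθ

variable {F N Rg}
variable {D : FiniteEpsData F (SU N)} {w : WorldP}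

/-- The regime forgotten: a record in the regime is a Stage-13 record. [cite: Balaban1989LargeFieldII, Thm 1 p.355 (bookkeeping)] -/
theorem IsRecordOfRecord₁₃CSepCoPROn.isRecordOfRecord₁₃CSepCoPR (h : IsRecordOfRecord₁₃CSepCoPROn F N Rg D w) : IsRecordOfRecord₁₃CSepCoPR F N D w := by
  obtain ⟨θ, -, hk⟩ := h
  exact hk.isRecordOfRecord₁₃CSepCoPR

/-- Its datum is a datum of record in the regime. [cite: Balaban1989LargeFieldII, Thm 1 p.355 (bookkeeping)] -/
theorem IsRecordOfRecord₁₃CSepCoPROn.isDatumOfRecord₁₃CSepCoPROn (h : IsRecordOfRecord₁₃CSepCoPROn F N Rg D w) : IsDatumOfRecord₁₃CSepCoPROn F N Rg D := by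
  obtain ⟨θ, hRg, hk⟩ := h
  obtain ⟨hP, hθ, hD⟩ := hk.exists_provisos
  exact ⟨θ, hP, hRg, hθ, hD⟩

/-- **THE TUPLE IN THE REGIME BEHIND A RECORD IN THE REGIME** — exactly the hypothesis shape of the (T-RATE) home's `s_R00x_rRec₁₂On_of_regime` (to be re-keyed at ₁₃) («every record of `Rec` comes with
an admissible tuple with provisos in the regime realising `D`»): ONE application. [cite: Balaban1989LargeFieldII, Thm 1 + (0.1) pp.355–356 (bookkeeping)] -/
theorem IsRecordOfRecord₁₃CSepCoPROn.exists_regime_tuple (h : IsRecordOfRecord₁₃CSepCoPROn F N Rg D w) :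
    ∃ (θ : Stage13RParams F N) (hP : θ.Provisos₁₃SepCoPR F N), Rg F θ ∧ θ.Admissible F N ∧ D = datumOfRecord₁₃SepCoPR F N θ hP :=
  h.isDatumOfRecord₁₃CSepCoPROn

/-- Monotone in the regime. [cite: Balaban1989LargeFieldII, Thm 1 p.355 (bookkeeping)] -/
theorem IsRecordOfRecord₁₃CSepCoPROn.mono {Rg' : (F : T4Family) → Stage13RParams F N → Prop} (hle : ∀ (F : T4Family) (θ : Stage13RParams F N), Rg F θ → Rg' F θ)
    (h : IsRecordOfRecord₁₃CSepCoPROn F N Rg D w) : IsRecordOfRecord₁₃CSepCoPROn F N Rg' D w := by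
  obtain ⟨θ, hRg, hk⟩ := h
  exact ⟨θ, hle F θ hRg, hk⟩

/-- The world's window is positive. [cite: Balaban1987RG1, Thm 1 p.259 (bookkeeping)] -/
theorem IsRecordOfRecord₁₃CSepCoPROn.gamma_pos (h : IsRecordOfRecord₁₃CSepCoPROn F N Rg D w) : 0 < w.γ := by
  obtain ⟨θ, -, hk⟩ := h
  exact hk.gamma_pos

/-- The world is bound to the datum's construction. [cite: Balaban1989LargeFieldII, Thm 1 + (0.1) pp.355–356 (bookkeeping)] -/
theorem IsRecordOfRecord₁₃CSepCoPROn.construction_eq (h : IsRecordOfRecord₁₃CSepCoPROn F N Rg D w) : w.C = D.C := by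
  obtain ⟨θ, -, hk⟩ := h
  exact hk.construction_eq

/-- A Stage-13 record keyed at a θ IN THE REGIME is a record in the regime (pointed intro). [cite: Balaban1989LargeFieldII, Thm 1 + (0.1) pp.355–356 (bookkeeping)] -/
theorem IsRateKey₁₃SepCoPR.isRecordOfRecord₁₃CSepCoPROn {θ : Stage13RParams F N} (hk : IsRateKey₁₃SepCoPR F N D w θ) (hRg : Rg F θ) : IsRecordOfRecord₁₃CSepCoPROn F N Rg D w :=
  ⟨θ, hRg, hk⟩

/-- At the trivial regime the record key IS `IsRecordOfRecord₁₃CSepCoPR`. [cite: Balaban1989LargeFieldII, Thm 1 p.355 (bookkeeping)] -/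
theorem isRecordOfRecord₁₃CSepCoPROn_true_iff : IsRecordOfRecord₁₃CSepCoPROn F N (fun _ _ => True) D w ↔ IsRecordOfRecord₁₃CSepCoPR F N D w :=
  ⟨fun h => h.isRecordOfRecord₁₃CSepCoPR, fun ⟨θ, hk⟩ => ⟨θ, trivial, hk⟩⟩

/-- **DATUM OF RECORD IN THE REGIME ⟺ RECORD IN THE REGIME AT SOME WORLD.** [cite: Balaban1989LargeFieldII, Thm 1 + (0.1) pp.355–356 (bookkeeping)] -/
theorem isDatumOfRecord₁₃CSepCoPROn_iff_exists_world : IsDatumOfRecord₁₃CSepCoPROn F N Rg D ↔ ∃ w : WorldP, IsRecordOfRecord₁₃CSepCoPROn F N Rg D w := by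
  constructor
  · rintro ⟨θ, hP, hRg, hθ, rfl⟩
    obtain ⟨w, hw, -⟩ := exists_world_isRecordOfRecord₁₃CSepCoPROn F N Rg θ hP hRg hθ ⟨hθ.toStage9.gamma_pos, le_rfl⟩
    exact ⟨w, hw⟩
  · rintro ⟨w, hw⟩
    exact hw.isDatumOfRecord₁₃CSepCoPROn

/-- **WORLD COMPANION IN THE REGIME AT ANY WINDOW BELOW THE CANONICAL ONE** (what an N17-type home-keying binder consumes once the U3 radius is pinned in `]0, h.params.γ]`).
[cite: Balaban1989LargeFieldII, Thm 1 + (0.1) pp.355–356 (bookkeeping)] -/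
theorem IsDatumOfRecord₁₃CSepCoPROn.exists_world (h : IsDatumOfRecord₁₃CSepCoPROn F N Rg D) {γw : ℝ} (hγw : 0 < γw ∧ γw ≤ h.params.γ) :
    ∃ w : WorldP, IsRecordOfRecord₁₃CSepCoPROn F N Rg D w ∧ w.γ = γw := by
  obtain ⟨w, hw, hγ⟩ := exists_world_isRecordOfRecord₁₃CSepCoPROn F N Rg h.params h.provisos h.regime h.admissible hγw
  exact ⟨w, h.eq_datumOfRecord₁₃SepCoPR ▸ hw, hγ⟩

/-- … in particular at the canonical window itself. [cite: Balaban1989LargeFieldII, Thm 1 + (0.1) pp.355–356 (bookkeeping)] -/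
theorem IsDatumOfRecord₁₃CSepCoPROn.exists_world_gamma (h : IsDatumOfRecord₁₃CSepCoPROn F N Rg D) :
    ∃ w : WorldP, IsRecordOfRecord₁₃CSepCoPROn F N Rg D w ∧ w.γ = h.params.γ :=
  h.exists_world ⟨h.gamma_pos, le_rfl⟩

/-- The ₅C shadow at the canonical parameter in the regime (for consumers keyed at ₅C). [cite: Balaban1989LargeFieldII, Thm 1 + (0.1) pp.355–356 (bookkeeping)] -/
theorem IsDatumOfRecord₁₃CSepCoPROn.exists_isRecordOfRecord₅C (h : IsDatumOfRecord₁₃CSepCoPROn F N Rg D) :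
    ∃ (D₅ : FiniteEpsData F (SU N)) (w : WorldP), IsRecordOfRecord₅C F N D₅ w ∧ D₅.C = D.C ∧ (∀ K g₀ k, D₅.dens K g₀ k = D.dens K g₀ k) ∧
      D₅.βfun = D.βfun ∧ D₅.av = D.av :=
  h.toC.exists_isRecordOfRecord₅C

end RecordKeyOn

/-! ## §6. Canonicalised readings RELATIVE TO THE REGIME — coherence for regime homes keyed «`∃ θ hP, Rg F θ ∧ θ.Admissible F N ∧ D = datumOfRecord₁₃SepCoPR F N θ hP ∧ S = cr F θ hP …`»

As `canon₁₃SepCoPR` (gen 2) for the C key: reading a regime-keyed record through `canon₁₃SepCoPROn Rg f` makes the admitted bundle a function of the DATUM, read at the canonical parameter IN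
THE REGIME, so two regime homes read through `canon₁₃SepCoPROn Rg` admit, at the same `(F, D, g₀, os)`, bundles read at ONE parameter (`exists_keyed_canon₁₃SepCoPROn_iff`,
`keyed_canon₁₃SepCoPROn_coherent`).  Off the class `canon₁₃SepCoPROn Rg f = f`. -/
section CanonOn

variable (F : T4Family) (N : ℕ) [NeZero N] (Rg : (F : T4Family) → Stage13RParams F N → Prop) {α : Sort*}

/-- **CANONICALISED READING RELATIVE TO THE REGIME**: read `f` at the canonical parameter in `Rg` of the datum `datumOfRecord₁₃SepCoPR F N θ hP` when that datum is of record in the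
regime, else at `(θ, hP)` itself.  Kernel bookkeeping (`Classical.dec`, `dite`). [cite: Balaban1989LargeFieldII, Thm 1 + (0.1) pp.355–356 (bookkeeping)] -/
def canon₁₃SepCoPROn (f : (θ : Stage13RParams F N) → θ.Provisos₁₃SepCoPR F N → α) (θ : Stage13RParams F N) (hP : θ.Provisos₁₃SepCoPR F N) : α := by
  classical
  exact if h : IsDatumOfRecord₁₃CSepCoPROn F N Rg (datumOfRecord₁₃SepCoPR F N θ hP) then f h.params h.provisos else f θ hP

variable {F N Rg}

/-- **`canon₁₃SepCoPROn Rg f θ hP = f h.params h.provisos`** whenever `(θ, hP)` realises a datum of record in the regime `D` with key `h`. [cite: Balaban1989LargeFieldII, Thm 1 + (0.1) pp.355–356 (bookkeeping)] -/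
theorem canon₁₃SepCoPROn_eq_of_eq {f : (θ : Stage13RParams F N) → θ.Provisos₁₃SepCoPR F N → α} {D : FiniteEpsData F (SU N)} (h : IsDatumOfRecord₁₃CSepCoPROn F N Rg D)
    (θ : Stage13RParams F N) (hP : θ.Provisos₁₃SepCoPR F N) (e : D = datumOfRecord₁₃SepCoPR F N θ hP) :
    canon₁₃SepCoPROn F N Rg f θ hP = f h.params h.provisos := by
  subst e
  unfold canon₁₃SepCoPROn
  rw [dif_pos h]

/-- At the canonical parameter in the regime `canon₁₃SepCoPROn Rg f` reads `f`. [cite: Balaban1989LargeFieldII, Thm 1 + (0.1) pp.355–356 (bookkeeping)] -/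
theorem canon₁₃SepCoPROn_params {f : (θ : Stage13RParams F N) → θ.Provisos₁₃SepCoPR F N → α} {D : FiniteEpsData F (SU N)} (h : IsDatumOfRecord₁₃CSepCoPROn F N Rg D) :
    canon₁₃SepCoPROn F N Rg f h.params h.provisos = f h.params h.provisos :=
  canon₁₃SepCoPROn_eq_of_eq h h.params h.provisos h.eq_datumOfRecord₁₃SepCoPR

/-- At an admissible tuple IN THE REGIME with provisos, `canon₁₃SepCoPROn Rg f` reads `f` at the canonical parameter in the regime of ITS datum. [cite: Balaban1989LargeFieldII, Thm 1 + (0.1) pp.355–356 (bookkeeping)] -/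
theorem canon₁₃SepCoPROn_eq_of_regime {f : (θ : Stage13RParams F N) → θ.Provisos₁₃SepCoPR F N → α} (θ : Stage13RParams F N) (hP : θ.Provisos₁₃SepCoPR F N) (hRg : Rg F θ)
    (hθ : θ.Admissible F N) :
    canon₁₃SepCoPROn F N Rg f θ hP = f (isDatumOfRecord₁₃CSepCoPROn_datumOfRecord₁₃SepCoPR F N Rg θ hP hRg hθ).params (isDatumOfRecord₁₃CSepCoPROn_datumOfRecord₁₃SepCoPR F N Rg θ hP hRg hθ).provisos :=
  canon₁₃SepCoPROn_eq_of_eq _ θ hP rfl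

/-- Off the class nothing is canonicalised. [cite: Balaban1989LargeFieldII, Thm 1 + (0.1) pp.355–356 (bookkeeping)] -/
theorem canon₁₃SepCoPROn_eq_self_of_not {f : (θ : Stage13RParams F N) → θ.Provisos₁₃SepCoPR F N → α} (θ : Stage13RParams F N) (hP : θ.Provisos₁₃SepCoPR F N)
    (hn : ¬ IsDatumOfRecord₁₃CSepCoPROn F N Rg (datumOfRecord₁₃SepCoPR F N θ hP)) : canon₁₃SepCoPROn F N Rg f θ hP = f θ hP := by
  unfold canon₁₃SepCoPROn
  rw [dif_neg hn]

/-- **THE KEYED-RECORD FACE, IN THE REGIME**: a regime-keyed record read through `canon₁₃SepCoPROn Rg f` IS the datum-keyed record «the bundle reads `f` at the canonical parameter in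
the regime of `D`», for every property `Φ` of the reading. [cite: Balaban1989LargeFieldII, Thm 1 + (0.1) pp.355–356 (bookkeeping)] -/
theorem exists_keyed_canon₁₃SepCoPROn_iff {f : (θ : Stage13RParams F N) → θ.Provisos₁₃SepCoPR F N → α} {D : FiniteEpsData F (SU N)} (Φ : α → Prop) :
    (∃ (θ : Stage13RParams F N) (hP : θ.Provisos₁₃SepCoPR F N), Rg F θ ∧ θ.Admissible F N ∧ D = datumOfRecord₁₃SepCoPR F N θ hP ∧ Φ (canon₁₃SepCoPROn F N Rg f θ hP)) ↔
      ∃ h : IsDatumOfRecord₁₃CSepCoPROn F N Rg D, Φ (f h.params h.provisos) := by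
  constructor
  · rintro ⟨θ, hP, hRg, hθ, e, hΦ⟩
    have h : IsDatumOfRecord₁₃CSepCoPROn F N Rg D := ⟨θ, hP, hRg, hθ, e⟩
    refine ⟨h, ?_⟩
    rwa [canon₁₃SepCoPROn_eq_of_eq (f := f) h θ hP e] at hΦ
  · rintro ⟨h, hΦ⟩
    refine ⟨h.params, h.provisos, h.regime, h.admissible, h.eq_datumOfRecord₁₃SepCoPR, ?_⟩
    rwa [canon₁₃SepCoPROn_params (f := f) h]

/-- **COHERENCE IN THE REGIME**: two regime-keyed records read through `canon₁₃SepCoPROn Rg` admit, at the same datum, readings AT THE SAME PARAMETER.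
[cite: Balaban1989LargeFieldII, Thm 1 + (0.1) pp.355–356 (bookkeeping)] -/
theorem keyed_canon₁₃SepCoPROn_coherent {β : Sort*} {f : (θ : Stage13RParams F N) → θ.Provisos₁₃SepCoPR F N → α} {g : (θ : Stage13RParams F N) → θ.Provisos₁₃SepCoPR F N → β}
    {D : FiniteEpsData F (SU N)} (Φ : α → Prop) (Ψ : β → Prop)
    (hΦ : ∃ (θ : Stage13RParams F N) (hP : θ.Provisos₁₃SepCoPR F N), Rg F θ ∧ θ.Admissible F N ∧ D = datumOfRecord₁₃SepCoPR F N θ hP ∧ Φ (canon₁₃SepCoPROn F N Rg f θ hP))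
    (hΨ : ∃ (θ : Stage13RParams F N) (hP : θ.Provisos₁₃SepCoPR F N), Rg F θ ∧ θ.Admissible F N ∧ D = datumOfRecord₁₃SepCoPR F N θ hP ∧ Ψ (canon₁₃SepCoPROn F N Rg g θ hP)) :
    ∃ h : IsDatumOfRecord₁₃CSepCoPROn F N Rg D, Φ (f h.params h.provisos) ∧ Ψ (g h.params h.provisos) := by
  obtain ⟨h, h₁⟩ := (exists_keyed_canon₁₃SepCoPROn_iff Φ).1 hΦ
  obtain ⟨h', h₂⟩ := (exists_keyed_canon₁₃SepCoPROn_iff Ψ).1 hΨ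
  exact ⟨h, h₁, h₂⟩

end CanonOn

/-! ## §7. THE GUARD OF RECORD «partition of unity ∧ non-degenerate present slots» and the CN instances

The route's Stage-13 items (rev 16, to be minted) bundle `θ.ZrUnity F N` (print's partition of unity for the residual 𝐓-weights, [Balaban1988Convergent] (3.16)–(3.20)) and
`θ.SlotsNondegenerate₁₃ F N` (no present slot of record is the zero density, (3.22)) into ONE conjunction on the datum's own parameter.  Named once as a regime; the «CN key» is
§4–§6 at that regime. -/

section Guard

variable (F : T4Family) (N : ℕ) [NeZero N]


/-- **THE CN KEY — «`D` is a datum of record, Stage 13, realised by an admissible tuple WITH print's partition of unity AND non-degenerate present slots»**: the datum key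
at the guard of record. [cite: Balaban1989LargeFieldII, Thm 1 + (0.1) pp.355–356; Balaban1988Convergent, (3.16)–(3.22) pp.268–269 (objects of record; bookkeeping)] -/
abbrev IsDatumOfRecord₁₃CSepCoPRN (D : FiniteEpsData F (SU N)) : Prop :=
  IsDatumOfRecord₁₃CSepCoPROn F N (unityNondeg₁₃R N) D

/-- **THE CN RECORD CLASS** at the guard of record. [cite: Balaban1989LargeFieldII, Thm 1 + (0.1) pp.355–356; Balaban1988Convergent, (3.16)–(3.22) pp.268–269 (objects of record; bookkeeping)] -/
abbrev IsRecordOfRecord₁₃CSepCoPRN (D : FiniteEpsData F (SU N)) (w : WorldP) : Prop :=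
  IsRecordOfRecord₁₃CSepCoPROn F N (unityNondeg₁₃R N) D w

/-- **The CN key, literally**: SOME Stage-13 parameter tuple with provisos, `(θ.ZrUnity F N ∧ θ.SlotsNondegenerate₁₃ F N)`, admissible, has `D` as its datum of record (`Iff.rfl`).
[cite: Balaban1989LargeFieldII, Thm 1 + (0.1) pp.355–356; Balaban1988Convergent, (3.16)–(3.22) pp.268–269 (bookkeeping)] -/
theorem isDatumOfRecord₁₃CSepCoPRN_iff (D : FiniteEpsData F (SU N)) :
    IsDatumOfRecord₁₃CSepCoPRN F N D ↔
      ∃ (θ : Stage13RParams F N) (h : θ.Provisos₁₃SepCoPR F N), (θ.ZrUnity F N ∧ θ.SlotsNondegenerate₁₃ F N) ∧ θ.Admissible F N ∧ D = datumOfRecord₁₃SepCoPR F N θ h :=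
  Iff.rfl

/-- **The CN record class, literally** (`Iff.rfl`). [cite: Balaban1989LargeFieldII, Thm 1 + (0.1) pp.355–356 (bookkeeping)] -/
theorem isRecordOfRecord₁₃CSepCoPRN_iff (D : FiniteEpsData F (SU N)) (w : WorldP) :
    IsRecordOfRecord₁₃CSepCoPRN F N D w ↔ ∃ θ : Stage13RParams F N, (θ.ZrUnity F N ∧ θ.SlotsNondegenerate₁₃ F N) ∧ IsRateKey₁₃SepCoPR F N D w θ :=
  Iff.rfl

/-- Intro at a guarded admissible tuple with provisos. [cite: Balaban1989LargeFieldII, Thm 1 + (0.1) pp.355–356 (bookkeeping)] -/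
theorem isDatumOfRecord₁₃CSepCoPRN_datumOfRecord₁₃SepCoPR (θ : Stage13RParams F N) (h : θ.Provisos₁₃SepCoPR F N) (hG : θ.ZrUnity F N ∧ θ.SlotsNondegenerate₁₃ F N) (hθ : θ.Admissible F N) :
    IsDatumOfRecord₁₃CSepCoPRN F N (datumOfRecord₁₃SepCoPR F N θ h) :=
  isDatumOfRecord₁₃CSepCoPROn_datumOfRecord₁₃SepCoPR F N _ θ h hG hθ

/-- **K0′ READS THE SAME AT THE CN DATUM**: some CN datum of record exists at `(F, N)` iff SOME Stage-13 parameter tuple satisfies every displayed proviso, print's partition of unity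
and non-degeneracy of the present slots, and is admissible — the body of the route's `Record12Inhabited` (rev 15) at `(F, N)`, verbatim; inhabitation is NOT claimed here.
[cite: Balaban1988Convergent, (2.7) p.255, (2.21) p.258, (2.28) p.259, (3.16)–(3.22) pp.268–269; Balaban1987RG1, (1.12)–(1.15) p.262 (hypothesis dictionary; bookkeeping)] -/
theorem exists_isDatumOfRecord₁₃CSepCoPRN_iff_exists_params :
    (∃ D : FiniteEpsData F (SU N), IsDatumOfRecord₁₃CSepCoPRN F N D) ↔
      ∃ θ : Stage13RParams F N, θ.Provisos₁₃SepCoPR F N ∧ (θ.ZrUnity F N ∧ θ.SlotsNondegenerate₁₃ F N) ∧ θ.Admissible F N :=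
  exists_isDatumOfRecord₁₃CSepCoPROn_iff_exists_params F N _

/-- … and iff some CN record exists. [cite: Balaban1989LargeFieldII, Thm 1 + (0.1) pp.355–356 (bookkeeping)] -/
theorem exists_isRecordOfRecord₁₃CSepCoPRN_iff_exists_params :
    (∃ (D : FiniteEpsData F (SU N)) (w : WorldP), IsRecordOfRecord₁₃CSepCoPRN F N D w) ↔
      ∃ θ : Stage13RParams F N, θ.Provisos₁₃SepCoPR F N ∧ (θ.ZrUnity F N ∧ θ.SlotsNondegenerate₁₃ F N) ∧ θ.Admissible F N :=
  (exists_isDatumOfRecord₁₃CSepCoPROn_iff_exists_record F N _).symm.trans (exists_isDatumOfRecord₁₃CSepCoPRN_iff_exists_params F N)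

/-- **THE K2′ ∕ K3′ JUNCTION**: a world-blind property at EVERY CN record ⟺ the θ-keyed sentence «`∀ θ (h : θ.Provisos₁₃SepCoPR F N), (θ.ZrUnity F N ∧ θ.SlotsNondegenerate₁₃ F N) →
θ.Admissible F N → P (datumOfRecord₁₃SepCoPR F N θ h)`» — the items' binder prefix (what a `Spine` ∕ endpoint composer over the CN record class reads the text off).
[cite: Balaban1989LargeFieldII, Thm 1 + (0.1) pp.355–356 (bookkeeping)] -/
theorem forall_isRecordOfRecord₁₃CSepCoPRN_iff (P : FiniteEpsData F (SU N) → Prop) :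
    (∀ (D : FiniteEpsData F (SU N)) (w : WorldP), IsRecordOfRecord₁₃CSepCoPRN F N D w → P D) ↔
      ∀ (θ : Stage13RParams F N) (h : θ.Provisos₁₃SepCoPR F N), (θ.ZrUnity F N ∧ θ.SlotsNondegenerate₁₃ F N) → θ.Admissible F N → P (datumOfRecord₁₃SepCoPR F N θ h) :=
  forall_isRecordOfRecord₁₃CSepCoPROn_iff F N _ P

/-- … datum-level form. [cite: Balaban1989LargeFieldII, Thm 1 + (0.1) pp.355–356 (bookkeeping)] -/
theorem forall_isDatumOfRecord₁₃CSepCoPRN_iff (P : FiniteEpsData F (SU N) → Prop) :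
    (∀ D : FiniteEpsData F (SU N), IsDatumOfRecord₁₃CSepCoPRN F N D → P D) ↔
      ∀ (θ : Stage13RParams F N) (h : θ.Provisos₁₃SepCoPR F N), (θ.ZrUnity F N ∧ θ.SlotsNondegenerate₁₃ F N) → θ.Admissible F N → P (datumOfRecord₁₃SepCoPR F N θ h) :=
  forall_isDatumOfRecord₁₃CSepCoPROn_iff F N _ P

/-- Every guarded admissible θ with provisos is a CN record at some world with any window `0 < γw ≤ θ.γ`. [cite: Balaban1989LargeFieldII, Thm 1 + (0.1) pp.355–356 (bookkeeping)] -/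
theorem exists_world_isRecordOfRecord₁₃CSepCoPRN (θ : Stage13RParams F N) (h : θ.Provisos₁₃SepCoPR F N) (hG : θ.ZrUnity F N ∧ θ.SlotsNondegenerate₁₃ F N) (hθ : θ.Admissible F N)
    {γw : ℝ} (hγw : 0 < γw ∧ γw ≤ θ.γ) : ∃ w : WorldP, IsRecordOfRecord₁₃CSepCoPRN F N (datumOfRecord₁₃SepCoPR F N θ h) w ∧ w.γ = γw :=
  exists_world_isRecordOfRecord₁₃CSepCoPROn F N _ θ h hG hθ hγw

variable {F N}
variable {D : FiniteEpsData F (SU N)} {w : WorldP}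

/-- **THE GUARD AT THE CANONICAL CN PARAMETER** — the one thing the C key cannot supply. [cite: Balaban1988Convergent, (3.16)–(3.22) pp.268–269 (bookkeeping)] -/
theorem IsDatumOfRecord₁₃CSepCoPRN.guard (h : IsDatumOfRecord₁₃CSepCoPRN F N D) : h.params.ZrUnity F N ∧ h.params.SlotsNondegenerate₁₃ F N :=
  h.regime

/-- Print's partition of unity at the canonical CN parameter. [cite: Balaban1988Convergent, (3.16)–(3.20) pp.268–269 (bookkeeping)] -/
theorem IsDatumOfRecord₁₃CSepCoPRN.zrUnity (h : IsDatumOfRecord₁₃CSepCoPRN F N D) : h.params.ZrUnity F N :=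
  h.regime.1

/-- Non-degeneracy of the present slots at the canonical CN parameter. [cite: Balaban1988Convergent, (3.22) p.269 (bookkeeping)] -/
theorem IsDatumOfRecord₁₃CSepCoPRN.slotsNondegenerate (h : IsDatumOfRecord₁₃CSepCoPRN F N D) : h.params.SlotsNondegenerate₁₃ F N :=
  h.regime.2

/-- **WHAT A CONSUMER PROVES UNDER THE GUARD ⟹ WHAT THE CN INSTANCE CARRIES** (the items' binder order: guard, then admissibility). [cite: Balaban1989LargeFieldII, Thm 1 p.355 (bookkeeping)] -/
theorem IsDatumOfRecord₁₃CSepCoPRN.forall_params {P : (D : FiniteEpsData F (SU N)) → (θ : Stage13RParams F N) → θ.Provisos₁₃SepCoPR F N → Prop}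
    (hP : ∀ (θ : Stage13RParams F N) (hθ : θ.Provisos₁₃SepCoPR F N), (θ.ZrUnity F N ∧ θ.SlotsNondegenerate₁₃ F N) → θ.Admissible F N → P (datumOfRecord₁₃SepCoPR F N θ hθ) θ hθ)
    (h : IsDatumOfRecord₁₃CSepCoPRN F N D) : P D h.params h.provisos :=
  IsDatumOfRecord₁₃CSepCoPROn.forall_params hP h

/-- A CN datum is a C datum (the guard forgotten; its C-canonical parameter is NOT asserted to satisfy the guard). [cite: Balaban1989LargeFieldII, Thm 1 p.355 (bookkeeping)] -/
theorem IsDatumOfRecord₁₃CSepCoPRN.isDatumOfRecord₁₃CSepCoPR (h : IsDatumOfRecord₁₃CSepCoPRN F N D) : IsDatumOfRecord₁₃CSepCoPR F N D :=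
  h.toC

/-- A CN record is a Stage-13 record. [cite: Balaban1989LargeFieldII, Thm 1 p.355 (bookkeeping)] -/
theorem IsRecordOfRecord₁₃CSepCoPRN.isRecordOfRecord₁₃CSepCoPR' (h : IsRecordOfRecord₁₃CSepCoPRN F N D w) : IsRecordOfRecord₁₃CSepCoPR F N D w :=
  h.isRecordOfRecord₁₃CSepCoPR

/-- The guarded tuple behind a CN record (feeds the ₁₃ re-key of `s_R00x_rRec₁₂On_of_regime 𝔯 ·` at `unityNondeg₁₃R N` in one application). [cite: Balaban1989LargeFieldII, Thm 1 + (0.1) pp.355–356 (bookkeeping)] -/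
theorem IsRecordOfRecord₁₃CSepCoPRN.exists_guarded_tuple (h : IsRecordOfRecord₁₃CSepCoPRN F N D w) :
    ∃ (θ : Stage13RParams F N) (hP : θ.Provisos₁₃SepCoPR F N), (θ.ZrUnity F N ∧ θ.SlotsNondegenerate₁₃ F N) ∧ θ.Admissible F N ∧ D = datumOfRecord₁₃SepCoPR F N θ hP :=
  h.exists_regime_tuple

/-- A datum of record whose C-canonical parameter satisfies the guard is a CN datum. [cite: Balaban1989LargeFieldII, Thm 1 p.355 (bookkeeping)] -/
theorem IsDatumOfRecord₁₃CSepCoPR.isDatumOfRecord₁₃CSepCoPRN_of_guard (h : IsDatumOfRecord₁₃CSepCoPR F N D) (hG : h.params.ZrUnity F N ∧ h.params.SlotsNondegenerate₁₃ F N) :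
    IsDatumOfRecord₁₃CSepCoPRN F N D :=
  h.isDatumOfRecord₁₃CSepCoPROn_of_regime_params hG

end Guard

/-! ## §8. THE ONE-WAY BRIDGE INTO THE `CoPR` KEYS (`Node00/Record13DatumKeyCoPR`, provisos `Provisos₁₃CoPR`): by def-T's `Stage13RParams.Provisos₁₃SepCoPR.toCore` and the
definitional agreement of the two data of record (def-T's `datumOfRecord₁₃SepCoPR_eq_coPR`, `rfl`), every datum ∕ record keyed on the provisos of this module (`Provisos₁₃SepCoPR`) is keyed on `Provisos₁₃CoPR`
AT THE SAME DATUM AND PARAMETER; NOT conversely (a `CoPR` record asserts no background-field bound), and there is NO bridge to or from the ‴ ∕ ⁗ ∕ `SepMixed` keys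
(their data read another background object). -/

section BridgeToCoPR

variable {F : T4Family} {N : ℕ} [NeZero N]
variable {D : FiniteEpsData F (SU N)} {w : WorldP} {Rg : (F : T4Family) → Stage13RParams F N → Prop} {θ : Stage13RParams F N}

/-- The θ-exposed `SepCoPR` key gives the `CoPR` one (same θ). [cite: Balaban1989LargeFieldII, Thm 1 + (0.1) pp.355–356 (bookkeeping)] -/
theorem IsRateKey₁₃SepCoPR.toCoPR (h : IsRateKey₁₃SepCoPR F N D w θ) : IsRateKey₁₃CoPR F N D w θ := by
  obtain ⟨hP, hθ, hD, hrest⟩ := h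
  exact ⟨hP.toCore, hθ, hD, hrest⟩

/-- A `SepCoPR`-keyed datum of record is a `CoPR`-keyed datum of record. [cite: Balaban1989LargeFieldII, Thm 1 + (0.1) pp.355–356 (bookkeeping)] -/
theorem IsDatumOfRecord₁₃CSepCoPR.toCoPR (h : IsDatumOfRecord₁₃CSepCoPR F N D) : IsDatumOfRecord₁₃CCoPR F N D := by
  obtain ⟨θ, hP, hθ, hD⟩ := h
  exact ⟨θ, hP.toCore, hθ, hD⟩

/-- … in every regime. [cite: Balaban1989LargeFieldII, Thm 1 + (0.1) pp.355–356 (bookkeeping)] -/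
theorem IsDatumOfRecord₁₃CSepCoPROn.toCoPR (h : IsDatumOfRecord₁₃CSepCoPROn F N Rg D) : IsDatumOfRecord₁₃CCoPROn F N Rg D := by
  obtain ⟨θ, hP, hR, hθ, hD⟩ := h
  exact ⟨θ, hP.toCore, hR, hθ, hD⟩

/-- … and for records in every regime. [cite: Balaban1989LargeFieldII, Thm 1 + (0.1) pp.355–356 (bookkeeping)] -/
theorem IsRecordOfRecord₁₃CSepCoPROn.toCoPR (h : IsRecordOfRecord₁₃CSepCoPROn F N Rg D w) : IsRecordOfRecord₁₃CCoPROn F N Rg D w := by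
  obtain ⟨θ, hR, hk⟩ := h
  exact ⟨θ, hR, hk.toCoPR⟩

/-- … at the guard of record. [cite: Balaban1988Convergent, (3.16)–(3.22) pp.268–269 (bookkeeping)] -/
theorem IsDatumOfRecord₁₃CSepCoPRN.toCoPR (h : IsDatumOfRecord₁₃CSepCoPRN F N D) : IsDatumOfRecord₁₃CCoPRN F N D :=
  IsDatumOfRecord₁₃CSepCoPROn.toCoPR h

/-- … at the guard of record, records. [cite: Balaban1988Convergent, (3.16)–(3.22) pp.268–269 (bookkeeping)] -/
theorem IsRecordOfRecord₁₃CSepCoPRN.toCoPR (h : IsRecordOfRecord₁₃CSepCoPRN F N D w) : IsRecordOfRecord₁₃CCoPRN F N D w :=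
  IsRecordOfRecord₁₃CSepCoPROn.toCoPR h

end BridgeToCoPR

/-! ## §9. THE RUN-BLIND DOORS `…SepCoP → …SepCoPR` along def-T's `Stage13RParams.ofRunBlind` (ONE-WAY; with def-T's `IsRecordOfRecord₁₃CSepCoPR.ofCoP`, «K0⁶ ⇐ K0⁵» at class level)

Every v1.5 `SepCoP`-keyed class instance IS a v1.6 `SepCoPR`-keyed one AT THE SAME DATUM (and world), the parameter being def-T's run-blind embedding
`Stage13RParams.ofRunBlind F N θ := ⟨θ, fun p => θ.Zt p.K⟩` (`Node00/Record13SepCoPR` §R2: `Stage13Params.Provisos₁₃SepCoP.ofRunBlind`, `datumOfRecord₁₃SepCoPR_ofRunBlind` (`rfl`);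
`Node00/Record13CoPR` §R1: `Stage12Params.ZtUnity.ofRunBlind`, `Stage13RParams.toStage5₁₃CoPR_ofRunBlind`).  NO CONVERSE: a run-indexed residual need not be run-blind (FINDING №8) —
nothing `SepCoPR → SepCoP` is statable as an implication of classes and none is filed. -/

section RunBlindDoors

variable {F : T4Family} {N : ℕ} [NeZero N]
variable {D : FiniteEpsData F (SU N)} {w : WorldP}

/-- **EVERY v1.5 DATUM OF RECORD (provisos of record) IS A v1.6 DATUM OF RECORD** (same datum; parameter `Stage13RParams.ofRunBlind F N h.params`).  One-way.
[cite: Balaban1989LargeFieldII, Thm 1 + (0.1) pp.355–356; Balaban1988Convergent, (3.16) p.268 (bookkeeping)] -/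
theorem IsDatumOfRecord₁₃CSepCoPR.ofCoP (h : IsDatumOfRecord₁₃CSepCoP F N D) : IsDatumOfRecord₁₃CSepCoPR F N D := by
  obtain ⟨θ, hP, hθ, hD⟩ := h
  exact ⟨Stage13RParams.ofRunBlind F N θ, hP.ofRunBlind, hθ, hD.trans (datumOfRecord₁₃SepCoPR_ofRunBlind hP).symm⟩

/-- **EVERY v1.5 KEYED RECORD IS A v1.6 KEYED RECORD at the run-blind embedding of its parameter** (same datum, same world; the Stage-5 view by
`Stage13RParams.toStage5₁₃CoPR_ofRunBlind`).  One-way. [cite: Balaban1989LargeFieldII, Thm 1 + (0.1) pp.355–356 (bookkeeping)] -/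
theorem IsRateKey₁₃SepCoPR.ofCoP {θ : Stage13Params F N} (hk : IsRateKey₁₃SepCoP F N D w θ) : IsRateKey₁₃SepCoPR F N D w (Stage13RParams.ofRunBlind F N θ) := by
  obtain ⟨hP, hθ, hD, hC, hγ, hL, hup⟩ := hk
  exact ⟨hP.ofRunBlind, hθ, hD.trans (datumOfRecord₁₃SepCoPR_ofRunBlind hP).symm, hC, hγ, hL,
    fun P => (hup P).trans (congrArg (fun ϑ => upOfRecord₅C F N ϑ P) (Stage13RParams.toStage5₁₃CoPR_ofRunBlind F N θ).symm)⟩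

/-- **REGIME FORM, DATUM**: a v1.5 datum of record IN a regime `Rg` is a v1.6 datum of record in any regime `RgR` the run-blind embedding carries `Rg` into.  One-way.
[cite: Balaban1989LargeFieldII, Thm 1 + (0.1) pp.355–356 (bookkeeping)] -/
theorem IsDatumOfRecord₁₃CSepCoPROn.ofCoP {Rg : (F : T4Family) → Stage13Params F N → Prop} {RgR : (F : T4Family) → Stage13RParams F N → Prop}
    (hRg : ∀ (F : T4Family) (θ : Stage13Params F N), Rg F θ → RgR F (Stage13RParams.ofRunBlind F N θ)) (h : IsDatumOfRecord₁₃CSepCoPOn F N Rg D) :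
    IsDatumOfRecord₁₃CSepCoPROn F N RgR D := by
  obtain ⟨θ, hP, hr, hθ, hD⟩ := h
  exact ⟨Stage13RParams.ofRunBlind F N θ, hP.ofRunBlind, hRg F θ hr, hθ, hD.trans (datumOfRecord₁₃SepCoPR_ofRunBlind hP).symm⟩

/-- **REGIME FORM, RECORD**: a v1.5 record IN a regime `Rg` is a v1.6 record in any regime `RgR` the run-blind embedding carries `Rg` into.  One-way.
[cite: Balaban1989LargeFieldII, Thm 1 + (0.1) pp.355–356 (bookkeeping)] -/
theorem IsRecordOfRecord₁₃CSepCoPROn.ofCoP {Rg : (F : T4Family) → Stage13Params F N → Prop} {RgR : (F : T4Family) → Stage13RParams F N → Prop}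
    (hRg : ∀ (F : T4Family) (θ : Stage13Params F N), Rg F θ → RgR F (Stage13RParams.ofRunBlind F N θ)) (h : IsRecordOfRecord₁₃CSepCoPOn F N Rg D w) :
    IsRecordOfRecord₁₃CSepCoPROn F N RgR D w := by
  obtain ⟨θ, hr, hk⟩ := h
  exact ⟨Stage13RParams.ofRunBlind F N θ, hRg F θ hr, IsRateKey₁₃SepCoPR.ofCoP hk⟩

/-- **CN FORM, DATUM**: a v1.5 CN datum of record (guard `unityNondeg₁₃ N`) is a v1.6 CN datum of record (guard `unityNondeg₁₃R N`), the partition of unity transported by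
def-T's `Stage12Params.ZtUnity.ofRunBlind`, slot non-degeneracy by `Iff.rfl`.  One-way — the class-level body of «K0⁶ ⇐ K0⁵» up to the node conjuncts.
[cite: Balaban1988Convergent, (3.16)–(3.22) pp.268–269; Balaban1989LargeFieldII, Thm 1 p.355 (bookkeeping)] -/
theorem IsDatumOfRecord₁₃CSepCoPRN.ofCoP (h : IsDatumOfRecord₁₃CSepCoPN F N D) : IsDatumOfRecord₁₃CSepCoPRN F N D :=
  IsDatumOfRecord₁₃CSepCoPROn.ofCoP (fun _ _ hG => ⟨hG.1.ofRunBlind, hG.2⟩) h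

/-- **CN FORM, RECORD**: a v1.5 CN record is a v1.6 CN record (same datum, same world).  One-way.
[cite: Balaban1988Convergent, (3.16)–(3.22) pp.268–269; Balaban1989LargeFieldII, Thm 1 p.355 (bookkeeping)] -/
theorem IsRecordOfRecord₁₃CSepCoPRN.ofCoP (h : IsRecordOfRecord₁₃CSepCoPN F N D w) : IsRecordOfRecord₁₃CSepCoPRN F N D w :=
  IsRecordOfRecord₁₃CSepCoPROn.ofCoP (fun _ _ hG => ⟨hG.1.ofRunBlind, hG.2⟩) h

end RunBlindDoors

end Literature.MathematicalPhysics.QuantumFieldTheory.Balaban1983to89.Node00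

end
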